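import Literature.Barriers.AnomalousDissipation.VortexSheetBurgers
import Literature.Analysis.FluidPDE.EulerSubsolutionCriterion
import Literature.Analysis.FunctionSpaces.TorusAxisAverageCalculus
import Literature.Analysis.FunctionSpaces.TorusWeakFormBookkeeping
import HarnessLib

/-!
# Székelyhidi's vortex-sheet subsolution, III: the weak identities, the subsolution property,
  the energy of the prescribed density

Topic `Barriers/AnomalousDissipation`, third layer of the proof of
`Literature.Barriers.AnomalousDissipation.Szekelyhidi2011_thm11` (Székelyhidi, C. R. Math. 349
(2011) 1063–1066, Thm. 1.1) from the convex-integration fact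
`Literature.Analysis.FluidPDE.Torus.Szekelyhidi2011_thm13` (op. cit. Thm. 1.3), after
`VortexSheetSubsolution.lean` (the explicit fields `v̄ = (α, 0)`, `ū = [[β, γ], [γ, -β]]`,
`q̄ = β`, `ē = ½ - κ(1 - α²)`, `κ = (ε + cα)/4`, the turbulent zone `U`, and the pointwise
relations (4), (5), (8)) and `VortexSheetBurgers.lean` (the one-dimensional integrations by parts
expressing that the rarefaction fan `α` is a weak solution of the Burgers equation (9)). All
statements here are proved; there are no new definitions.

Székelyhidi 2011, §2: "With these choices the system (3) reduces to `∂ₜα + ∂_{x₂}γ = 0` (9) …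
Set `α` to be the (unique) viscosity solution … With this choice of `U` and `ē` the triple
`(v̄, ū, q̄)` satisfies (8) for all time … The kinetic energy is given by `E(t) = ∫ ē dx`. Using
(10) and (11) we find the dissipation rate to be `dE/dt = -ε(2/3)λ(1-λ)` (12)."

## Contents

* `VortexSheet.isWeaklyDivFree_vbar` — `div v̄(t) = 0` weakly on `T²` for every `t` (pairing
  with `∇θ` only sees the average of `θ` along the first axis, `Torus.axisAvg`, whose
  `x₁`-derivative vanishes: `fderiv_single_eq_zero_of_forall_add_single`).
* `VortexSheet.weakBurgers_onePlusOne` — the `1+1`-dimensional weak Burgers identity of the fan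
  with initial datum `sgn`: `∫₀¹∫ (α ∂ₜG + γ ∂_yG) = -∫ sgn(y) G(0,y) dy` for `G ∈ C¹` vanishing at
  `t = 1` (space and time integrations by parts of `VortexSheetBurgers` — the time one redone with
  the datum, `intervalIntegral_fanFun_mul_deriv_datum` — and Fubini; `∂ₜα ∈ L¹`,
  `integrable_dαfun_prod`).
* `VortexSheet.momentum_identity` — **the momentum equation of (3) with initial datum**: for
  every `E²`-valued space–time test field `ψ` on `[0,1)`,
  `∫₀¹∫ [⟪v̄, ∂ₜψ⟫ + ∑ᵢⱼ ūᵢⱼ ∂ⱼψᵢ + q̄ div ψ] = -∫ ⟪v₀, ψ(0)⟫`, `v₀` the vortex-sheet datum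
  (`v̄(0) = v₀`, `vbar_zero`): reduction to test fields invariant along the first axis by axis
  averaging (`integral_momentumIntegrand_eq_axisAvg`), for which the integrand is
  `α ∂ₜψ₁ + γ ∂₂ψ₁` (`momentumIntegrand_of_invariant`, the printed reduction of (3) to (9)) and
  the `T²`-integral is an integral over the second axis (`integral_comp_eval_one`,
  `integral_unitAddCircle_eq_intervalIntegral_half`); `momentum_identity_of_le_one` is the same
  on `[0,T)`, `T ≤ 1`.
* `VortexSheet.isEulerSubsolutionOn` — **`(v̄, ū, q̄)` is a subsolution with respect to `ē`
  on `T² × (0,1)`** for `|ε| + |c| ≤ 1` (op. cit. Def. 1.2, `Torus.IsEulerSubsolutionOn`).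
* `VortexSheet.integral_two_mul_ebar` — `∫ 2ē(x,t) dx = 1 - εt/3` for `0 < t ≤ 1` ((12)
  integrated, `λ = ½`; the odd modulation `cα(1-α²)` does not contribute);
  `lintegral_enorm_sq_vortexSheetData` — `∫ |v₀|² = 1`.
* `VortexSheet.eq_of_ebar_zero_ae_eq` — for `0 < t ≤ 1`, `ē(0,c,t) = ē(0,c',t)` a.e. forces
  `c = c'` (the modulation is visible on the punctured inner fan, a set of positive measure): the
  device producing infinitely many *distinct* energy-conserving solutions downstream.
* `VortexSheet.continuous_integral_inner_vbar` — `v̄ ∈ C(ℝ; L²_w(T²))` (dominated convergence).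
* small assembly facts: `norm_sq_eq_two_mul_of_vecMulVec_sub_eq` (trace of (6): `|v|² = 2ē`),
  `norm_vbar_sq_eq_two_mul_ebar_of_not_mem_U`, `timeDeriv_eq_zero_of_lt`, `fderiv_zero_field`,
  `divergence_zero_field`, `divergence_eq_sum_fderiv`.

The assembly of Thm. 1.1 from Thm. 1.3 and this file is `VortexSheetWild.lean`.

## References

* L. Székelyhidi Jr., C. R. Math. Acad. Sci. Paris 349 (2011) 1063–1066, Def. 1.2, Thm. 1.3–1.4,
  §2, (3), (9)–(12) (`Szekelyhidi2011`).
* C. De Lellis, L. Székelyhidi Jr., Arch. Ration. Mech. Anal. 195 (2010) 225–260, Prop. 2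
  (`DeLellisSzekelyhidi2010`).
-/

open MeasureTheory Set Filter Function intervalIntegral
open scoped InnerProductSpace ContDiff ENNReal
open Literature.Analysis.FunctionSpaces
open Literature.Analysis.FunctionSpaces.Torus (stLift timeDeriv IsWeaklyDivFree IsSpaceTimeTest
  IsSpaceTimeTestIoo IsDivFreeTest IsSmooth IsContDiff proj lift liftAt axisAvg divergence partialDeriv
  convect axisAvg_apply axisAvg_add_single proj_smul_single integral_inner_eq_integral_inner_axisAvg
  integrable_inner_shift_of_bound)
open Literature.Analysis.FluidPDE.Torus (IsEulerSubsolutionOn)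

noncomputable section

namespace Literature.Barriers.AnomalousDissipation

namespace VortexSheet

/-! ## Derivatives along an invariant axis vanish -/

section Invariant

variable {d : Type*} [Fintype d] [DecidableEq d]
variable {F : Type*} [NormedAddCommGroup F] [NormedSpace ℝ F]

/-- **A `C¹` function on `T^d` invariant under the translations along the `i`-th axis has
vanishing derivative in the direction `eᵢ`.** [folklore] -/
theorem fderiv_single_eq_zero_of_forall_add_single {f : UnitAddTorus d → F} (hf : IsContDiff 1 f)
    {i : d} (hinv : ∀ (s : UnitAddCircle) (x : UnitAddTorus d), f (x + Pi.single i s) = f x)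
    (x : UnitAddTorus d) : Torus.fderiv f x (EuclideanSpace.single i 1) = 0 := by
  rw [← Torus.lineDeriv_eq_fderiv_apply hf]
  unfold Torus.lineDeriv
  have h : (fun t : ℝ => f (x + proj (t • EuclideanSpace.single i (1 : ℝ)))) = fun _ => f x := by
    funext t
    rw [proj_smul_single, hinv]
  rw [h, deriv_const]

end Invariant

/-! ## Invariance of the explicit fields along the first axis -/

/-- Adding `s e₀` does not change the second coordinate. [folklore] -/
theorem add_single_zero_apply_one (x : (UnitAddTorus (Fin 2))) (s : UnitAddCircle) :
    (x + (Pi.single 0 s : (UnitAddTorus (Fin 2)))) 1 = x 1 := by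
  simp

/-- `v̄(t)` does not depend on `x₁`. [folklore] -/
theorem vbar_add_single (t : ℝ) (s : UnitAddCircle) (x : (UnitAddTorus (Fin 2))) :
    vbar t (x + Pi.single 0 s) = vbar t x := by
  simp only [vbar, add_single_zero_apply_one]

/-- `ū(t)` does not depend on `x₁`. [folklore] -/
theorem ubar_add_single (t : ℝ) (s : UnitAddCircle) (x : (UnitAddTorus (Fin 2))) :
    ubar t (x + Pi.single 0 s) = ubar t x := by
  simp only [ubar, add_single_zero_apply_one]

/-- `q̄(t)` does not depend on `x₁`. [folklore] -/
theorem qbar_add_single (t : ℝ) (s : UnitAddCircle) (x : (UnitAddTorus (Fin 2))) :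
    qbar t (x + Pi.single 0 s) = qbar t x := by
  simp only [qbar, add_single_zero_apply_one]

/-- `ē(t)` does not depend on `x₁`. [folklore] -/
theorem ebar_add_single (ε c t : ℝ) (s : UnitAddCircle) (x : (UnitAddTorus (Fin 2))) :
    ebar ε c t (x + Pi.single 0 s) = ebar ε c t x := by
  simp only [ebar, add_single_zero_apply_one]

/-- The vortex-sheet datum does not depend on `x₁`. [folklore] -/
theorem vortexSheetData_add_single (s : UnitAddCircle) (x : (UnitAddTorus (Fin 2))) :
    vortexSheetData (x + Pi.single 0 s) = vortexSheetData x := by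
  simp only [vortexSheetData, add_single_zero_apply_one]

/-! ## `v̄(t)` is weakly divergence free -/

/-- `⟪v̄(t,x), w⟫ = α(t, x₂) w₀`. [folklore] -/
theorem inner_vbar (t : ℝ) (x : (UnitAddTorus (Fin 2))) (w : (EuclideanSpace ℝ (Fin 2))) : ⟪vbar t x, w⟫_ℝ = α t (x 1) * w 0 := by
  rw [vbar, EuclideanSpace.inner_eq_star_dotProduct]
  simp [Fin.sum_univ_two, dotProduct]
  ring

/-- `v̄(t) ∈ L²(T²)` (bounded and measurable). [folklore] -/
theorem memLp_vbar (t : ℝ) : MemLp (vbar t) 2 volume :=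
  MemLp.of_bound (measurable_vbar_slice t).aestronglyMeasurable 1 (ae_of_all _ (norm_vbar_le t))

/-- **`v̄(t) = (α(x₂,t), 0)` is weakly divergence free** for every `t`: pairing with `∇θ` only sees
the average `θ̄` of `θ` along the first axis, and `∂₁θ̄ = 0`. [cite: Szekelyhidi2011, §2 (3)] -/
theorem isWeaklyDivFree_vbar (t : ℝ) : IsWeaklyDivFree (vbar t) := by
  intro θ hθ
  have hA : MemLp (vbar t) 2 volume := memLp_vbar t
  obtain ⟨C, hC⟩ := isCompact_univ.exists_bound_of_continuousOn hθ.gradient.continuous.continuousOn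
  rw [integral_inner_eq_integral_inner_axisAvg 0 (vbar_add_single t) hA.1 hθ.gradient.integrable
      (integrable_inner_shift_of_bound _ (hA.integrable one_le_two)
        hθ.gradient.continuous.aestronglyMeasurable fun x => hC x (mem_univ x)),
    ← Torus.gradient_axisAvg hθ 0]
  have hsm : IsSmooth (axisAvg 0 θ) := hθ.axisAvg 0
  have hzero : ∀ x, Torus.gradient (axisAvg 0 θ) x 0 = 0 := by
    intro x
    have h := fderiv_single_eq_zero_of_forall_add_single (hsm.isContDiff (by simp))
      (axisAvg_add_single 0 θ) x
    rw [← Torus.inner_gradient_left, EuclideanSpace.inner_single_right] at h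
    simpa using h
  simp [inner_vbar, hzero]


/-! ## Time: `∫₀¹ α h' = -s h(0) - ∫₀¹ ∂ₜα h` with the initial datum -/

/-- **Integration by parts in `t` across the fan, with the initial datum**: for `0 < |y| ≤ ½` and
`h ∈ C¹(ℝ)` with `h(1) = 0`,
`∫₀¹ α(t,y) h'(t) dt = -sgn(y) h(0) - ∫₀¹ ∂ₜα(t,y) h(t) dt` (before the fan reaches `y`,
`t ≤ 2|y|`, `α = sgn y` is constant; afterwards `α = 2y/t`; the boundary terms at `t = 2|y|`
cancel and the one at `t = 0` is the datum). [cite: Szekelyhidi2011, §2 (9)–(10)] -/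
theorem intervalIntegral_fanFun_mul_deriv_datum {y : ℝ} (hy : |y| ≤ 1 / 2) (hy0 : y ≠ 0)
    {h h' : ℝ → ℝ} (hh : ∀ t, HasDerivAt h (h' t) t) (hh' : Continuous h') (h1 : h 1 = 0) :
    ∫ t in (0 : ℝ)..1, fanFun t y * h' t =
      -(sgn y * h 0) - ∫ t in (0 : ℝ)..1, dαfun t y * h t := by
  have hhc : Continuous h := continuous_iff_continuousAt.2 fun t => (hh t).continuousAt
  -- the fan reaches `y` at time `T = 2|y| ∈ (0, 1]`
  set T : ℝ := 2 * |y| with hT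
  have hypos : 0 < |y| := abs_pos.2 hy0
  have hT0 : 0 < T := by positivity
  have hT1 : T ≤ 1 := by linarith
  have hsgn : 2 * y / T = sgn y := two_mul_div_two_mul_abs hy0
  have hIR1 : IntervalIntegrable (fun t => dαfun t y * h t) volume 0 T := by
    rw [intervalIntegrable_iff_integrableOn_Icc_of_le hT0.le]
    refine integrableOn_zero.congr_fun (fun t ht => ?_) measurableSet_Icc
    show (0 : ℝ) = dαfun t y * h t
    rw [dαfun_of_not_lt (not_lt.2 ht.2), zero_mul]
  have hcont2 : ContinuousOn (fun t => -(2 * y / t ^ 2) * h t) (Icc T 1) := by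
    refine ContinuousOn.mul (ContinuousOn.neg (ContinuousOn.div continuousOn_const
      (by fun_prop) fun t ht => ?_)) hhc.continuousOn
    exact pow_ne_zero 2 (by linarith [ht.1] : t ≠ 0)
  have hIR2 : IntervalIntegrable (fun t => dαfun t y * h t) volume T 1 := by
    rw [intervalIntegrable_iff_integrableOn_Ioc_of_le hT1]
    refine ((hcont2.integrableOn_compact isCompact_Icc).mono_set Ioc_subset_Icc_self).congr_fun
      (fun t ht => ?_) measurableSet_Ioc
    show -(2 * y / t ^ 2) * h t = dαfun t y * h t
    rw [dαfun_of_lt ht.1]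
  rw [← intervalIntegral.integral_add_adjacent_intervals (intervalIntegrable_fanFun_mul y hh' 0 T)
      (intervalIntegrable_fanFun_mul y hh' T 1),
    ← intervalIntegral.integral_add_adjacent_intervals hIR1 hIR2]
  -- piece `[0, T]`: `α = sgn y` constant, `∂ₜα = 0`
  have hL1 : ∫ t in (0 : ℝ)..T, fanFun t y * h' t = sgn y * h T - sgn y * h 0 := by
    have heq : ∫ t in (0 : ℝ)..T, fanFun t y * h' t = ∫ t in (0 : ℝ)..T, sgn y * h' t := by
      refine intervalIntegral.integral_congr fun t ht => ?_
      rw [uIcc_of_le hT0.le] at ht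
      show fanFun t y * h' t = sgn y * h' t
      rw [fanFun_eq_sgn hy0 ht.2]
    rw [heq, intervalIntegral.integral_const_mul,
      intervalIntegral.integral_eq_sub_of_hasDerivAt (fun t _ => hh t) (hh'.intervalIntegrable _ _)]
    ring
  have hR1 : ∫ t in (0 : ℝ)..T, dαfun t y * h t = 0 := by
    rw [intervalIntegral.integral_congr (g := fun _ => (0 : ℝ)) fun t ht => ?_,
      intervalIntegral.integral_zero]
    rw [uIcc_of_le hT0.le] at ht
    show dαfun t y * h t = 0
    rw [dαfun_of_not_lt (not_lt.2 ht.2), zero_mul]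
  -- piece `[T, 1]`: `α = 2y/t`, integrate by parts
  have hu : ∀ t ∈ uIcc T 1, HasDerivAt (fun t : ℝ => 2 * y / t) (-(2 * y / t ^ 2)) t := by
    intro t ht
    rw [uIcc_of_le hT1] at ht
    have ht0 : t ≠ 0 := by linarith [ht.1]
    have h := (hasDerivAt_const t (2 * y)).div (hasDerivAt_id t) ht0
    refine h.congr_deriv ?_
    simp only [id_eq]
    ring
  have hL2 : ∫ t in T..(1 : ℝ), fanFun t y * h' t =
      -(sgn y * h T) + ∫ t in T..(1 : ℝ), 2 * y / t ^ 2 * h t := by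
    have heq : ∫ t in T..(1 : ℝ), fanFun t y * h' t = ∫ t in T..(1 : ℝ), 2 * y / t * h' t := by
      refine intervalIntegral.integral_congr fun t ht => ?_
      rw [uIcc_of_le hT1] at ht
      show fanFun t y * h' t = 2 * y / t * h' t
      rw [fanFun_of_abs_le (by linarith [ht.1]) (by linarith [ht.1])]
    have hu' : IntervalIntegrable (fun t : ℝ => -(2 * y / t ^ 2)) volume T 1 := by
      refine ContinuousOn.intervalIntegrable ?_
      rw [uIcc_of_le hT1]
      refine ContinuousOn.neg (ContinuousOn.div continuousOn_const (by fun_prop) fun t ht => ?_)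
      exact pow_ne_zero 2 (by linarith [ht.1] : t ≠ 0)
    rw [heq, intervalIntegral.integral_mul_deriv_eq_deriv_mul hu (fun t _ => hh t) hu'
      (hh'.intervalIntegrable _ _), h1, mul_zero, zero_sub, hsgn]
    have hneg : ∫ t in T..(1 : ℝ), -(2 * y / t ^ 2) * h t =
        -∫ t in T..(1 : ℝ), 2 * y / t ^ 2 * h t := by
      rw [← intervalIntegral.integral_neg]
      refine intervalIntegral.integral_congr fun t _ => ?_
      show -(2 * y / t ^ 2) * h t = -(2 * y / t ^ 2 * h t)
      ring
    rw [hneg]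
    ring
  have hR2 : ∫ t in T..(1 : ℝ), dαfun t y * h t = -∫ t in T..(1 : ℝ), 2 * y / t ^ 2 * h t := by
    rw [← intervalIntegral.integral_neg]
    refine intervalIntegral.integral_congr_uIoo fun t ht => ?_
    rw [uIoo_of_le hT1] at ht
    show dαfun t y * h t = -(2 * y / t ^ 2 * h t)
    rw [dαfun_of_lt ht.1]
    ring
  rw [hL1, hR1, hL2, hR2]
  ring

/-! ## The a.e. time derivative of the fan is integrable on `(0,1) × (-½, ½]` -/

/-- `‖∂ₜα(t,y)‖ₑ ≤ (1/t) 1_{(-t/2, t/2)}(y)` for `t > 0`. [folklore] -/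
theorem enorm_dαfun_le {t : ℝ} (ht : 0 < t) (y : ℝ) :
    ‖dαfun t y‖ₑ ≤ (Ioo (-(t / 2)) (t / 2)).indicator (fun _ => ENNReal.ofReal (1 / t)) y := by
  by_cases h : 2 * |y| < t
  · have hy : y ∈ Ioo (-(t / 2)) (t / 2) := by
      have h' : |y| < t / 2 := by linarith
      rw [abs_lt] at h'
      exact ⟨h'.1, h'.2⟩
    rw [indicator_of_mem hy, Real.enorm_eq_ofReal_abs]
    exact ENNReal.ofReal_le_ofReal (abs_dαfun_le ht y)
  · rw [dαfun_of_not_lt h, enorm_zero]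
    exact bot_le

/-- **`∂ₜα ∈ L¹((0,1) × (-½, ½])`**: `∫₀¹ ∫ |∂ₜα| ≤ ∫₀¹ (1/t) · t dt = 1`. [folklore] -/
theorem integrable_dαfun_prod :
    Integrable (uncurry dαfun)
      ((volume.restrict (Ioo (0 : ℝ) 1)).prod (volume.restrict (Ioc (-(1 / 2 : ℝ)) (1 / 2)))) := by
  refine ⟨measurable_dαfun.aestronglyMeasurable, ?_⟩
  unfold HasFiniteIntegral
  rw [lintegral_prod _ measurable_dαfun.enorm.aemeasurable]
  have hbound : ∀ t ∈ Ioo (0 : ℝ) 1,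
      ∫⁻ y in Ioc (-(1 / 2 : ℝ)) (1 / 2), ‖uncurry dαfun (t, y)‖ₑ ≤ 1 := by
    intro t ht
    calc ∫⁻ y in Ioc (-(1 / 2 : ℝ)) (1 / 2), ‖uncurry dαfun (t, y)‖ₑ
        ≤ ∫⁻ y in Ioc (-(1 / 2 : ℝ)) (1 / 2),
            (Ioo (-(t / 2)) (t / 2)).indicator (fun _ => ENNReal.ofReal (1 / t)) y :=
          lintegral_mono fun y => enorm_dαfun_le ht.1 y
      _ ≤ ∫⁻ y, (Ioo (-(t / 2)) (t / 2)).indicator (fun _ => ENNReal.ofReal (1 / t)) y :=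
          setLIntegral_le_lintegral _ _
      _ = ENNReal.ofReal (1 / t) * volume (Ioo (-(t / 2)) (t / 2)) :=
          lintegral_indicator_const measurableSet_Ioo _
      _ = 1 := by
          rw [Real.volume_Ioo, ← ENNReal.ofReal_mul (le_of_lt (one_div_pos.2 ht.1))]
          have : 1 / t * (t / 2 - -(t / 2)) = 1 := by
            rw [show t / 2 - -(t / 2) = t by ring, one_div, inv_mul_cancel₀ ht.1.ne']
          rw [this, ENNReal.ofReal_one]
  calc ∫⁻ t in Ioo (0 : ℝ) 1, ∫⁻ y in Ioc (-(1 / 2 : ℝ)) (1 / 2), ‖uncurry dαfun (t, y)‖ₑ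
      ≤ ∫⁻ _ in Ioo (0 : ℝ) 1, 1 := setLIntegral_mono' measurableSet_Ioo hbound
    _ < ⊤ := by simp

/-! ## The `1+1`-dimensional weak identity of the rarefaction fan with initial datum -/

section OnePlusOne

variable {G Gt Gy : ℝ → ℝ → ℝ}

/-- A jointly continuous function on `ℝ²` is bounded on `[0,1] × [-1,1]`. [folklore] -/
theorem exists_bound_of_continuous_uncurry₂ (hG : Continuous (uncurry G)) :
    ∃ M : ℝ, 0 ≤ M ∧ ∀ t ∈ Icc (0 : ℝ) 1, ∀ y ∈ Icc (-1 : ℝ) 1, |G t y| ≤ M := by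
  obtain ⟨M, hM⟩ := (isCompact_Icc.prod isCompact_Icc).exists_bound_of_continuousOn
    (s := Icc (0 : ℝ) 1 ×ˢ Icc (-1 : ℝ) 1) hG.continuousOn
  refine ⟨|M|, abs_nonneg M, fun t ht y hy => ?_⟩
  have h := hM (t, y) ⟨ht, hy⟩
  simp only [uncurry_apply_pair, Real.norm_eq_abs] at h
  exact h.trans (le_abs_self M)

/-- The product measure on `(0,1) × (-½, ½]` is finite. [folklore] -/
theorem isFiniteMeasure_prod_restrict :
    IsFiniteMeasure ((volume.restrict (Ioo (0 : ℝ) 1)).prod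
      (volume.restrict (Ioc (-(1 / 2 : ℝ)) (1 / 2)))) := by
  haveI : Fact (volume (Ioo (0 : ℝ) 1) < ⊤) := ⟨measure_Ioo_lt_top⟩
  haveI : Fact (volume (Ioc (-(1 / 2 : ℝ)) (1 / 2)) < ⊤) := ⟨measure_Ioc_lt_top⟩
  infer_instance

/-- Integrability on `(0,1) × (-½, ½]` of `α · Θ` for a jointly continuous `Θ` (bounded
integrand on a finite measure space). [folklore] -/
theorem integrable_fanFun_mul_prod (hΘ : Continuous (uncurry Gt)) :
    Integrable (uncurry fun t y => fanFun t y * Gt t y)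
      ((volume.restrict (Ioo (0 : ℝ) 1)).prod (volume.restrict (Ioc (-(1 / 2 : ℝ)) (1 / 2)))) := by
  haveI := isFiniteMeasure_prod_restrict
  obtain ⟨M, hM0, hM⟩ := exists_bound_of_continuous_uncurry₂ hΘ
  have hm : AEStronglyMeasurable (uncurry fun t y => fanFun t y * Gt t y)
      ((volume.restrict (Ioo (0 : ℝ) 1)).prod (volume.restrict (Ioc (-(1 / 2 : ℝ)) (1 / 2)))) :=
    (measurable_fanFun.mul hΘ.measurable).aestronglyMeasurable
  refine (integrable_const M).mono' hm ?_
  have hS : ∀ᵐ p : ℝ × ℝ ∂((volume.restrict (Ioo (0 : ℝ) 1)).prod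
      (volume.restrict (Ioc (-(1 / 2 : ℝ)) (1 / 2)))), p ∈ Ioo (0 : ℝ) 1 ×ˢ Ioc (-(1 / 2 : ℝ)) (1 / 2) := by
    rw [Measure.prod_restrict]
    exact ae_restrict_mem (measurableSet_Ioo.prod measurableSet_Ioc)
  filter_upwards [hS] with p hp
  rw [Real.norm_eq_abs]
  show |fanFun p.1 p.2 * Gt p.1 p.2| ≤ M
  rw [abs_mul]
  have h1 := abs_fanFun_le p.1 p.2
  have h2 := hM p.1 (Ioo_subset_Icc_self hp.1) p.2 ⟨by linarith [hp.2.1], by linarith [hp.2.2]⟩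
  nlinarith [abs_nonneg (fanFun p.1 p.2), abs_nonneg (Gt p.1 p.2)]

/-- Integrability on `(0,1) × (-½, ½]` of `∂ₜα · G` for a jointly continuous `G`
(`∂ₜα ∈ L¹`, `G` bounded). [folklore] -/
theorem integrable_dαfun_mul_prod (hG : Continuous (uncurry G)) :
    Integrable (uncurry fun t y => dαfun t y * G t y)
      ((volume.restrict (Ioo (0 : ℝ) 1)).prod (volume.restrict (Ioc (-(1 / 2 : ℝ)) (1 / 2)))) := by
  obtain ⟨M, hM0, hM⟩ := exists_bound_of_continuous_uncurry₂ hG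
  have hm : AEStronglyMeasurable (uncurry fun t y => dαfun t y * G t y)
      ((volume.restrict (Ioo (0 : ℝ) 1)).prod (volume.restrict (Ioc (-(1 / 2 : ℝ)) (1 / 2)))) :=
    (measurable_dαfun.mul hG.measurable).aestronglyMeasurable
  refine (integrable_dαfun_prod.norm.mul_const M).mono' hm ?_
  have hS : ∀ᵐ p : ℝ × ℝ ∂((volume.restrict (Ioo (0 : ℝ) 1)).prod
      (volume.restrict (Ioc (-(1 / 2 : ℝ)) (1 / 2)))), p ∈ Ioo (0 : ℝ) 1 ×ˢ Ioc (-(1 / 2 : ℝ)) (1 / 2) := by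
    rw [Measure.prod_restrict]
    exact ae_restrict_mem (measurableSet_Ioo.prod measurableSet_Ioc)
  filter_upwards [hS] with p hp
  rw [Real.norm_eq_abs]
  show |dαfun p.1 p.2 * G p.1 p.2| ≤ ‖uncurry dαfun p‖ * M
  rw [abs_mul, uncurry, Real.norm_eq_abs]
  exact mul_le_mul_of_nonneg_left
    (hM p.1 (Ioo_subset_Icc_self hp.1) p.2 ⟨by linarith [hp.2.1], by linarith [hp.2.2]⟩) (abs_nonneg _)

/-- **The rarefaction fan solves `∂ₜα + ∂_yγ = 0` weakly on `(0,1) × T¹` with initial datum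
`sgn`** (Székelyhidi 2011, §2, (9)–(10)), in the `1+1`-dimensional form: for `G ∈ C¹(ℝ²)`
(partial derivatives `Gt`, `Gy`, all jointly continuous) with `G(1, ·) = 0`,
`∫₀¹ ∫_{-½}^{½} (α ∂ₜG + γ ∂_yG) dy dt = -∫_{-½}^{½} sgn(y) G(0,y) dy`. Proof: the space
integration by parts `∫ γ ∂_yG = ∫ ∂ₜα G` (`intervalIntegral_γfun_mul_deriv`), the time integration
by parts with datum (`intervalIntegral_fanFun_mul_deriv_datum`) and Fubini. [cite: Szekelyhidi2011, §2 (9)–(10)] -/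
theorem weakBurgers_onePlusOne (hG : Continuous (uncurry G)) (hGt : Continuous (uncurry Gt))
    (hGy : Continuous (uncurry Gy)) (hdt : ∀ t y, HasDerivAt (fun τ => G τ y) (Gt t y) t)
    (hdy : ∀ t y, HasDerivAt (fun y' => G t y') (Gy t y) y) (h1 : ∀ y, G 1 y = 0) :
    ∫ t in Ioo (0 : ℝ) 1, ∫ y in (-(1 / 2 : ℝ))..(1 / 2), (fanFun t y * Gt t y + γfun t y * Gy t y) =
      -∫ y in (-(1 / 2 : ℝ))..(1 / 2), sgn y * G 0 y := by
  have hhalf : (-(1 / 2 : ℝ)) ≤ 1 / 2 := by norm_num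
  have hF := integrable_fanFun_mul_prod hGt
  have hD := integrable_dαfun_mul_prod hG
  -- Step 1: split the inner integral and integrate by parts in space
  have hinner : ∀ t ∈ Ioo (0 : ℝ) 1,
      ∫ y in (-(1 / 2 : ℝ))..(1 / 2), (fanFun t y * Gt t y + γfun t y * Gy t y) =
        (∫ y in Ioc (-(1 / 2 : ℝ)) (1 / 2), fanFun t y * Gt t y) +
          ∫ y in Ioc (-(1 / 2 : ℝ)) (1 / 2), dαfun t y * G t y := by
    intro t ht
    have hc1 : Continuous fun y => fanFun t y * Gt t y :=
      (continuous_fanFun_right ht.1).mul (hGt.comp (Continuous.prodMk_right t))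
    have hc2 : Continuous fun y => γfun t y * Gy t y :=
      (continuous_γfun_right ht.1).mul (hGy.comp (Continuous.prodMk_right t))
    rw [intervalIntegral.integral_add (hc1.intervalIntegrable _ _) (hc2.intervalIntegrable _ _),
      intervalIntegral_γfun_mul_deriv ht.1 ht.2 (hdy t) (hGy.comp (Continuous.prodMk_right t)),
      intervalIntegral.integral_of_le hhalf, intervalIntegral.integral_of_le hhalf]
  rw [setIntegral_congr_fun measurableSet_Ioo hinner]
  -- Step 2: split the time integral, Fubini in both terms
  have hIF : Integrable (fun t => ∫ y in Ioc (-(1 / 2 : ℝ)) (1 / 2), fanFun t y * Gt t y)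
      (volume.restrict (Ioo (0 : ℝ) 1)) := hF.integral_prod_left
  have hID : Integrable (fun t => ∫ y in Ioc (-(1 / 2 : ℝ)) (1 / 2), dαfun t y * G t y)
      (volume.restrict (Ioo (0 : ℝ) 1)) := hD.integral_prod_left
  rw [integral_add hIF hID]
  rw [show (∫ t in Ioo (0 : ℝ) 1, ∫ y in Ioc (-(1 / 2 : ℝ)) (1 / 2), fanFun t y * Gt t y) =
      ∫ y in Ioc (-(1 / 2 : ℝ)) (1 / 2), ∫ t in Ioo (0 : ℝ) 1, fanFun t y * Gt t y from
    integral_integral_swap hF,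
    show (∫ t in Ioo (0 : ℝ) 1, ∫ y in Ioc (-(1 / 2 : ℝ)) (1 / 2), dαfun t y * G t y) =
      ∫ y in Ioc (-(1 / 2 : ℝ)) (1 / 2), ∫ t in Ioo (0 : ℝ) 1, dαfun t y * G t y from
    integral_integral_swap hD]
  -- Step 3: time integration by parts with datum, for a.e. `y`
  have htime : ∀ᵐ y ∂(volume.restrict (Ioc (-(1 / 2 : ℝ)) (1 / 2))),
      ∫ t in Ioo (0 : ℝ) 1, fanFun t y * Gt t y =
        -(sgn y * G 0 y) - ∫ t in Ioo (0 : ℝ) 1, dαfun t y * G t y := by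
    have hne : ∀ᵐ y ∂(volume : Measure ℝ), y ≠ 0 := by
      have h0 : volume ({0} : Set ℝ) = 0 := Real.volume_singleton
      filter_upwards [measure_eq_zero_iff_ae_notMem.1 h0] with y hy
      exact fun h => hy (Set.mem_singleton_iff.2 h)
    filter_upwards [ae_restrict_of_ae hne, ae_restrict_mem measurableSet_Ioc] with y hy0 hy
    have hyabs : |y| ≤ 1 / 2 := abs_le.2 ⟨by linarith [hy.1], hy.2⟩
    have h := intervalIntegral_fanFun_mul_deriv_datum hyabs hy0 (fun t => hdt t y)
      (hGt.comp (Continuous.prodMk_left y)) (h1 y)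
    rw [intervalIntegral.integral_of_le zero_le_one, intervalIntegral.integral_of_le zero_le_one,
      integral_Ioc_eq_integral_Ioo, integral_Ioc_eq_integral_Ioo (f := fun t => dαfun t y * G t y)] at h
    exact h
  rw [integral_congr_ae htime]
  have hID' : Integrable (fun y => ∫ t in Ioo (0 : ℝ) 1, dαfun t y * G t y)
      (volume.restrict (Ioc (-(1 / 2 : ℝ)) (1 / 2))) := hD.integral_prod_right
  have hIS : Integrable (fun y => -(sgn y * G 0 y)) (volume.restrict (Ioc (-(1 / 2 : ℝ)) (1 / 2))) := by
    haveI : Fact (volume (Ioc (-(1 / 2 : ℝ)) (1 / 2)) < ⊤) := ⟨measure_Ioc_lt_top⟩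
    obtain ⟨M, hM0, hM⟩ := exists_bound_of_continuous_uncurry₂ hG
    have hsm : Measurable sgn := by
      unfold sgn
      exact Measurable.ite (measurableSet_lt measurable_const measurable_id) measurable_const
        measurable_const
    have hm : AEStronglyMeasurable (fun y => -(sgn y * G 0 y))
        (volume.restrict (Ioc (-(1 / 2 : ℝ)) (1 / 2))) :=
      ((hsm.mul (hG.comp (Continuous.prodMk_right 0)).measurable).neg).aestronglyMeasurable
    refine (integrable_const M).mono' hm ?_
    filter_upwards [ae_restrict_mem measurableSet_Ioc] with y hy
    rw [norm_neg, Real.norm_eq_abs, abs_mul]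
    have hs : |sgn y| ≤ 1 := by unfold sgn; split_ifs <;> simp
    have h2 := hM 0 ⟨le_rfl, zero_le_one⟩ y ⟨by linarith [hy.1], by linarith [hy.2]⟩
    nlinarith [abs_nonneg (sgn y), abs_nonneg (G 0 y)]
  rw [integral_sub hIS hID', intervalIntegral.integral_of_le hhalf, MeasureTheory.integral_neg]
  ring

end OnePlusOne


/-! ## Integrals over `T²` of functions of `x₂`; the fundamental interval -/

/-- **A function of `x₂` alone integrates over `T²` as over `T¹`** (the coordinate projection
preserves the Haar probability measures). [folklore] -/
theorem integral_comp_eval_one {E : Type*} [NormedAddCommGroup E] [NormedSpace ℝ E]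
    {g : UnitAddCircle → E} (hg : AEStronglyMeasurable g volume) :
    ∫ x : (UnitAddTorus (Fin 2)), g (x 1) = ∫ b, g b := by
  have hmp : MeasurePreserving (fun x : (UnitAddTorus (Fin 2)) => x 1) volume volume :=
    measurePreserving_eval (fun _ : Fin 2 => (volume : Measure UnitAddCircle)) 1
  have h := integral_map (μ := (volume : Measure (UnitAddTorus (Fin 2)))) hmp.measurable.aemeasurable (f := g)
    (by rw [hmp.map_eq]; exact hg)
  rw [hmp.map_eq] at h
  exact h.symm

/-- The Haar integral over `T¹ = ℝ/ℤ` as the integral over the fundamental interval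
`(-½, ½]`. [folklore] -/
theorem integral_unitAddCircle_eq_intervalIntegral_half {E : Type*} [NormedAddCommGroup E]
    [NormedSpace ℝ E] (g : UnitAddCircle → E) :
    ∫ b, g b = ∫ y in (-(1 / 2 : ℝ))..(1 / 2), g (y : UnitAddCircle) := by
  have h := UnitAddCircle.intervalIntegral_preimage (-(1 / 2 : ℝ)) g
  norm_num at h
  exact h.symm

/-- On the open fundamental interval, `α(t, ↑y) = fanFun t y`. [folklore] -/
theorem α_coe_of_mem_Ioo {t y : ℝ} (hy : y ∈ Ioo (-(1 / 2 : ℝ)) (1 / 2)) :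
    α t (y : UnitAddCircle) = fanFun t y :=
  α_coe ⟨hy.1.le, hy.2⟩

/-- On the open fundamental interval, `γ(t, ↑y) = γfun t y`. [folklore] -/
theorem γ_coe_of_mem_Ioo {t y : ℝ} (hy : y ∈ Ioo (-(1 / 2 : ℝ)) (1 / 2)) :
    γ t (y : UnitAddCircle) = γfun t y := by
  rw [γ, γfun, α_coe_of_mem_Ioo hy]

/-- On the open fundamental interval, the vortex-sheet profile is `sgn`. [folklore] -/
theorem vortexSheetProfile_coe_of_mem_Ioo {y : ℝ} (hy : y ∈ Ioo (-(1 / 2 : ℝ)) (1 / 2)) :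
    vortexSheetProfile (y : UnitAddCircle) = sgn y := by
  rw [← α_zero, α_coe_of_mem_Ioo hy, fanFun_of_nonpos le_rfl]

/-- `⟪v₀(x), w⟫ = s(x₂) w₀` for the vortex-sheet datum. [folklore] -/
theorem inner_vortexSheetData (x : (UnitAddTorus (Fin 2))) (w : (EuclideanSpace ℝ (Fin 2))) :
    ⟪vortexSheetData x, w⟫_ℝ = vortexSheetProfile (x 1) * w 0 := by
  rw [vortexSheetData, EuclideanSpace.inner_eq_star_dotProduct]
  simp [Fin.sum_univ_two, dotProduct]
  ring

/-! ## Torus calculus: components and the divergence through the Fréchet derivative -/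

section Calculus

variable {d : Type*} [Fintype d] [DecidableEq d]

omit [DecidableEq d] in
/-- Components commute with the torus derivative: `D(uᵢ)(x) w = (Du(x) w)ᵢ` for `C¹` fields. [folklore] -/
theorem fderiv_coord_apply {u : UnitAddTorus d → EuclideanSpace ℝ d} (hu : IsContDiff 1 u)
    (i : d) (x : UnitAddTorus d) (w : EuclideanSpace ℝ d) :
    Torus.fderiv (fun y => u y i) x w = Torus.fderiv u x w i := by
  have hd : DifferentiableAt ℝ (liftAt u x) 0 :=
    ((hu.liftAt x).differentiable one_ne_zero).differentiableAt
  have h : liftAt (fun y => u y i) x =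
      (EuclideanSpace.proj i : EuclideanSpace ℝ d →L[ℝ] ℝ) ∘ liftAt u x := by
    funext v; rfl
  rw [Torus.fderiv, Torus.fderiv, h,
    ((EuclideanSpace.proj i).hasFDerivAt.comp (0 : EuclideanSpace ℝ d) hd.hasFDerivAt).fderiv]
  rfl

/-- **The divergence through the Fréchet derivative**: `div u (x) = ∑ᵢ (Du(x) eᵢ)ᵢ` for `C¹`
fields. [folklore] -/
theorem divergence_eq_sum_fderiv {u : UnitAddTorus d → EuclideanSpace ℝ d} (hu : IsContDiff 1 u)
    (x : UnitAddTorus d) :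
    divergence u x = ∑ i, Torus.fderiv u x (EuclideanSpace.single i 1) i := by
  rw [divergence]
  refine Finset.sum_congr rfl fun i _ => ?_
  have hui : IsContDiff 1 (fun y => u y i) :=
    (EuclideanSpace.proj i : EuclideanSpace ℝ d →L[ℝ] ℝ).contDiff.comp hu
  rw [Torus.partialDeriv_eq_fderiv_apply hui, fderiv_coord_apply hu]

end Calculus

/-! ## Fields on `T²` invariant along the first axis: reduction to the second axis -/

section AxisReduction

variable {F : Type*} [NormedAddCommGroup F] [NormedSpace ℝ F]

/-- A point of `T²` is the sum of its two coordinate components. [folklore] -/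
theorem eq_single_one_add_single_zero (x : (UnitAddTorus (Fin 2))) :
    x = (Pi.single 1 (x 1) : (UnitAddTorus (Fin 2))) + Pi.single 0 (x 0) := by
  funext i
  fin_cases i <;> simp

/-- An invariant field is determined by its values on the second axis. [folklore] -/
theorem apply_eq_apply_single_of_forall_add_single {β : Type*} {f : (UnitAddTorus (Fin 2)) → β}
    (hinv : ∀ (s : UnitAddCircle) (x : (UnitAddTorus (Fin 2))), f (x + Pi.single 0 s) = f x) (x : (UnitAddTorus (Fin 2))) :
    f x = f (Pi.single 1 (x 1) : (UnitAddTorus (Fin 2))) := by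
  conv_lhs => rw [eq_single_one_add_single_zero x]
  exact hinv _ _

omit [NormedAddCommGroup F] [NormedSpace ℝ F] in
/-- The re-centred lifts of an invariant field at `x` and at `(0, x₂)` coincide. [folklore] -/
theorem liftAt_eq_liftAt_single_of_forall_add_single {f : (UnitAddTorus (Fin 2)) → F}
    (hinv : ∀ (s : UnitAddCircle) (x : (UnitAddTorus (Fin 2))), f (x + Pi.single 0 s) = f x) (x : (UnitAddTorus (Fin 2))) :
    liftAt f x = liftAt f (Pi.single 1 (x 1) : (UnitAddTorus (Fin 2))) := by
  funext v
  rw [Torus.liftAt_apply, Torus.liftAt_apply, apply_eq_apply_single_of_forall_add_single hinv,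
    apply_eq_apply_single_of_forall_add_single hinv ((Pi.single 1 (x 1) : (UnitAddTorus (Fin 2))) + proj v)]
  congr 2

/-- The torus derivative of an invariant field at `x` is that at `(0, x₂)`. [folklore] -/
theorem fderiv_eq_fderiv_single_of_forall_add_single {f : (UnitAddTorus (Fin 2)) → F}
    (hinv : ∀ (s : UnitAddCircle) (x : (UnitAddTorus (Fin 2))), f (x + Pi.single 0 s) = f x) (x : (UnitAddTorus (Fin 2))) :
    Torus.fderiv f x = Torus.fderiv f (Pi.single 1 (x 1) : (UnitAddTorus (Fin 2))) := by
  rw [Torus.fderiv, Torus.fderiv, liftAt_eq_liftAt_single_of_forall_add_single hinv]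

/-- The time derivative of an invariant space–time field at `x` is that at `(0, x₂)`. [folklore] -/
theorem timeDeriv_eq_timeDeriv_single_of_forall_add_single {ψ : ℝ → (UnitAddTorus (Fin 2)) → F}
    (hinv : ∀ (t : ℝ) (s : UnitAddCircle) (x : (UnitAddTorus (Fin 2))), ψ t (x + Pi.single 0 s) = ψ t x) (t : ℝ) (x : (UnitAddTorus (Fin 2))) :
    timeDeriv ψ t x = timeDeriv ψ t (Pi.single 1 (x 1) : (UnitAddTorus (Fin 2))) := by
  simp only [Torus.timeDeriv]
  congr 1
  funext τ
  exact apply_eq_apply_single_of_forall_add_single (hinv τ) x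

/-- `0 + proj (s e₂) = (0, ↑s)` on `T²`. [folklore] -/
theorem zero_add_proj_smul_single_one (s : ℝ) :
    (0 : (UnitAddTorus (Fin 2))) + proj (s • EuclideanSpace.single (1 : Fin 2) (1 : ℝ)) = Pi.single 1 (s : UnitAddCircle) := by
  rw [zero_add, proj_smul_single]

/-- **The spatial derivative along the second axis as a one-dimensional derivative**: for a `C¹`
field `f` on `T²`, `y ↦ f(0, ↑y)` has derivative `Df(0,↑y) e₂` at `y`. [folklore] -/
theorem hasDerivAt_comp_single_one {f : (UnitAddTorus (Fin 2)) → F} (hf : IsContDiff 1 f) (y : ℝ) :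
    HasDerivAt (fun y' : ℝ => f (Pi.single 1 (y' : UnitAddCircle)))
      (Torus.fderiv f (Pi.single 1 (y : UnitAddCircle)) (EuclideanSpace.single 1 1)) y := by
  have h := Torus.hasDerivAt_comp_add_proj_smul hf (0 : (UnitAddTorus (Fin 2))) (EuclideanSpace.single 1 (1 : ℝ)) y
  simp only [zero_add_proj_smul_single_one] at h
  rwa [Torus.lineDeriv_eq_fderiv_apply hf] at h

end AxisReduction

/-! ## The momentum identity for test fields invariant along the first axis -/

section InvariantTest

variable {ψ : ℝ → (UnitAddTorus (Fin 2)) → (EuclideanSpace ℝ (Fin 2))}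

/-- Slices of a smooth space–time field with time support below `T' < 1` vanish at `t = 1`. [folklore] -/
theorem IsSpaceTimeTest.apply_one (hψ : IsSpaceTimeTest 1 ψ) : ψ 1 = 0 := by
  obtain ⟨-, T', hT', h0⟩ := hψ
  exact h0 1 hT'.le

/-- **The momentum integrand of the explicit subsolution against an invariant test field**:
`⟪v̄, ∂ₜψ⟫ + ū : ∇ψ + q̄ div ψ = α ∂ₜψ₁ + γ ∂₂ψ₁` pointwise (`∂₁ψ = 0`, and the `β`-terms cancel:
this is "with these choices the system (3) reduces to `∂ₜα + ∂_{x₂}γ = 0`", Székelyhidi 2011, §2).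
[cite: Szekelyhidi2011, §2 (9)] -/
theorem momentumIntegrand_of_invariant (hψ : IsSpaceTimeTest 1 ψ)
    (hinv : ∀ (t : ℝ) (s : UnitAddCircle) (x : (UnitAddTorus (Fin 2))), ψ t (x + Pi.single 0 s) = ψ t x)
    (t : ℝ) (x : (UnitAddTorus (Fin 2))) :
    ⟪vbar t x, timeDeriv ψ t x⟫_ℝ +
        ∑ i, ∑ j, ubar t x i j * Torus.fderiv (ψ t) x (EuclideanSpace.single j 1) i +
        qbar t x * divergence (ψ t) x =
      α t (x 1) * timeDeriv ψ t x 0 +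
        γ t (x 1) * Torus.fderiv (ψ t) x (EuclideanSpace.single 1 1) 0 := by
  have hC1 : IsContDiff 1 (ψ t) := (hψ.isSmooth_slice t).isContDiff (by simp)
  have h0 : Torus.fderiv (ψ t) x (EuclideanSpace.single 0 1) = 0 :=
    fderiv_single_eq_zero_of_forall_add_single hC1 (hinv t) x
  rw [inner_vbar, divergence_eq_sum_fderiv hC1, Fin.sum_univ_two, Fin.sum_univ_two, Fin.sum_univ_two,
    Fin.sum_univ_two, h0]
  simp [qbar]
  ring

/-- The one-dimensional data of an invariant test field are jointly continuous: the profile. [folklore] -/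
theorem continuous_profile (hψ : IsSpaceTimeTest 1 ψ) :
    Continuous (uncurry fun t (y : ℝ) => ψ t (Pi.single 1 (y : UnitAddCircle)) 0) := by
  have h1 : Continuous fun p : ℝ × ℝ => (p.1, (Pi.single 1 (p.2 : UnitAddCircle) : (UnitAddTorus (Fin 2)))) :=
    continuous_fst.prodMk ((continuous_single (A := fun _ : Fin 2 => UnitAddCircle) 1).comp
      ((AddCircle.continuous_mk' (1 : ℝ)).comp continuous_snd))
  exact (EuclideanSpace.proj (0 : Fin 2)).continuous.comp (hψ.continuous_uncurry.comp h1)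

/-- The one-dimensional data of an invariant test field are jointly continuous: the time
derivative of the profile. [folklore] -/
theorem continuous_profile_timeDeriv (hψ : IsSpaceTimeTest 1 ψ) :
    Continuous (uncurry fun t (y : ℝ) => timeDeriv ψ t (Pi.single 1 (y : UnitAddCircle)) 0) :=
  continuous_profile hψ.timeDeriv

/-- The one-dimensional data of an invariant test field are jointly continuous: the space
derivative of the profile. [folklore] -/
theorem continuous_profile_fderiv (hψ : IsSpaceTimeTest 1 ψ) :
    Continuous (uncurry fun t (y : ℝ) =>
      Torus.fderiv (ψ t) (Pi.single 1 (y : UnitAddCircle)) (EuclideanSpace.single 1 1) 0) := by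
  have h1 : Continuous fun p : ℝ × ℝ => (p.1, (Pi.single 1 (p.2 : UnitAddCircle) : (UnitAddTorus (Fin 2)))) :=
    continuous_fst.prodMk ((continuous_single (A := fun _ : Fin 2 => UnitAddCircle) 1).comp
      ((AddCircle.continuous_mk' (1 : ℝ)).comp continuous_snd))
  have h2 := hψ.continuous_uncurry_lineDeriv (EuclideanSpace.single 1 1)
  have h3 : (uncurry fun t (y : ℝ) =>
      Torus.fderiv (ψ t) (Pi.single 1 (y : UnitAddCircle)) (EuclideanSpace.single 1 1) 0) =
      (EuclideanSpace.proj (0 : Fin 2)) ∘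
        (uncurry fun t x => Torus.lineDeriv (ψ t) x (EuclideanSpace.single 1 1)) ∘
        fun p : ℝ × ℝ => (p.1, (Pi.single 1 (p.2 : UnitAddCircle) : (UnitAddTorus (Fin 2)))) := by
    funext p
    simp only [Function.comp_apply, uncurry]
    rw [Torus.lineDeriv_eq_fderiv_apply ((hψ.isSmooth_slice p.1).isContDiff (by simp))]
    rfl
  rw [h3]
  exact (EuclideanSpace.proj (0 : Fin 2)).continuous.comp (h2.comp h1)

/-- **The momentum identity with initial datum for invariant test fields**: for a space–time test
field `ψ` on `[0,1)` (`T²`-periodic, `E²`-valued) invariant along the first axis,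
`∫₀¹∫ [⟪v̄, ∂ₜψ⟫ + ū : ∇ψ + q̄ div ψ] = -∫ ⟪v₀, ψ(0)⟫` (reduction to the `1+1`-dimensional weak
Burgers identity `weakBurgers_onePlusOne` along the second axis). [cite: Szekelyhidi2011, §2 (3), (9)–(10)] -/
theorem momentum_identity_of_invariant (hψ : IsSpaceTimeTest 1 ψ)
    (hinv : ∀ (t : ℝ) (s : UnitAddCircle) (x : (UnitAddTorus (Fin 2))), ψ t (x + Pi.single 0 s) = ψ t x) :
    ∫ t in Ioo (0 : ℝ) 1, ∫ x, (⟪vbar t x, timeDeriv ψ t x⟫_ℝ +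
        ∑ i, ∑ j, ubar t x i j * Torus.fderiv (ψ t) x (EuclideanSpace.single j 1) i +
        qbar t x * divergence (ψ t) x) =
      -∫ x, ⟪vortexSheetData x, ψ 0 x⟫_ℝ := by
  -- the one-dimensional data
  set G : ℝ → ℝ → ℝ := fun t y => ψ t (Pi.single 1 (y : UnitAddCircle)) 0 with hG_def
  set Gt : ℝ → ℝ → ℝ := fun t y => timeDeriv ψ t (Pi.single 1 (y : UnitAddCircle)) 0 with hGt_def
  set Gy : ℝ → ℝ → ℝ := fun t y =>
    Torus.fderiv (ψ t) (Pi.single 1 (y : UnitAddCircle)) (EuclideanSpace.single 1 1) 0 with hGy_def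
  have hG : Continuous (uncurry G) := continuous_profile hψ
  have hGt : Continuous (uncurry Gt) := continuous_profile_timeDeriv hψ
  have hGy : Continuous (uncurry Gy) := continuous_profile_fderiv hψ
  have hdt : ∀ t y, HasDerivAt (fun τ => G τ y) (Gt t y) t := fun t y =>
    (EuclideanSpace.proj (0 : Fin 2) : EuclideanSpace ℝ (Fin 2) →L[ℝ] ℝ).hasFDerivAt.comp_hasDerivAt t
      (Torus.hasDerivAt_slice_timeDeriv hψ.1 t (Pi.single 1 (y : UnitAddCircle)))
  have hdy : ∀ t y, HasDerivAt (fun y' => G t y') (Gy t y) y := fun t y =>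
    (EuclideanSpace.proj (0 : Fin 2) : EuclideanSpace ℝ (Fin 2) →L[ℝ] ℝ).hasFDerivAt.comp_hasDerivAt y
      (hasDerivAt_comp_single_one ((hψ.isSmooth_slice t).isContDiff (by simp)) y)
  have h1 : ∀ y, G 1 y = 0 := fun y => by simp [hG_def, IsSpaceTimeTest.apply_one hψ]
  have hB := weakBurgers_onePlusOne hG hGt hGy hdt hdy h1
  have hhalf : (-(1 / 2 : ℝ)) ≤ 1 / 2 := by norm_num
  have hcs : Continuous fun b : UnitAddCircle => (Pi.single 1 b : (UnitAddTorus (Fin 2))) :=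
    continuous_single (A := fun _ : Fin 2 => UnitAddCircle) 1
  -- the left-hand side, slice by slice
  have hL : ∀ t : ℝ, ∫ x, (⟪vbar t x, timeDeriv ψ t x⟫_ℝ +
        ∑ i, ∑ j, ubar t x i j * Torus.fderiv (ψ t) x (EuclideanSpace.single j 1) i +
        qbar t x * divergence (ψ t) x) =
      ∫ y in (-(1 / 2 : ℝ))..(1 / 2), (fanFun t y * Gt t y + γfun t y * Gy t y) := by
    intro t
    set K : UnitAddCircle → ℝ := fun b => α t b * timeDeriv ψ t (Pi.single 1 b) 0 +
      γ t b * Torus.fderiv (ψ t) (Pi.single 1 b) (EuclideanSpace.single 1 1) 0 with hK_def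
    have hpt : ∀ x : (UnitAddTorus (Fin 2)), ⟪vbar t x, timeDeriv ψ t x⟫_ℝ +
        ∑ i, ∑ j, ubar t x i j * Torus.fderiv (ψ t) x (EuclideanSpace.single j 1) i +
        qbar t x * divergence (ψ t) x = K (x 1) := by
      intro x
      rw [momentumIntegrand_of_invariant hψ hinv, timeDeriv_eq_timeDeriv_single_of_forall_add_single hinv,
        fderiv_eq_fderiv_single_of_forall_add_single (hinv t)]
    have hc1 : Continuous fun b : UnitAddCircle => timeDeriv ψ t (Pi.single 1 b) 0 :=
      (EuclideanSpace.proj (0 : Fin 2) : EuclideanSpace ℝ (Fin 2) →L[ℝ] ℝ).continuous.comp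
        ((hψ.timeDeriv.continuous_uncurry.comp (Continuous.prodMk_right t)).comp hcs)
    have hc2 : Continuous fun b : UnitAddCircle =>
        Torus.fderiv (ψ t) (Pi.single 1 b) (EuclideanSpace.single 1 1) 0 := by
      have h2 := (hψ.continuous_uncurry_lineDeriv (EuclideanSpace.single 1 1)).comp
        (Continuous.prodMk_right t)
      have h3 : (fun b : UnitAddCircle => Torus.fderiv (ψ t) (Pi.single 1 b) (EuclideanSpace.single 1 1) 0) =
          (EuclideanSpace.proj (0 : Fin 2)) ∘
            (uncurry fun t x => Torus.lineDeriv (ψ t) x (EuclideanSpace.single 1 1)) ∘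
            (fun x : (UnitAddTorus (Fin 2)) => (t, x)) ∘ fun b : UnitAddCircle => (Pi.single 1 b : (UnitAddTorus (Fin 2))) := by
        funext b
        simp only [Function.comp_apply, uncurry]
        rw [Torus.lineDeriv_eq_fderiv_apply ((hψ.isSmooth_slice t).isContDiff (by simp))]
        rfl
      rw [h3]
      exact (EuclideanSpace.proj (0 : Fin 2) : EuclideanSpace ℝ (Fin 2) →L[ℝ] ℝ).continuous.comp ((h2.comp hcs))
    have hmeas : AEStronglyMeasurable K volume := by
      have hαm : Measurable (α t) := measurable_α t
      have hγm : Measurable (γ t) := by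
        unfold γ
        exact ((measurable_const.sub (hαm.pow_const 2)).neg).div_const 4
      exact ((hαm.mul hc1.measurable).add (hγm.mul hc2.measurable)).aestronglyMeasurable
    calc ∫ x, (⟪vbar t x, timeDeriv ψ t x⟫_ℝ +
          ∑ i, ∑ j, ubar t x i j * Torus.fderiv (ψ t) x (EuclideanSpace.single j 1) i +
          qbar t x * divergence (ψ t) x)
        = ∫ x : (UnitAddTorus (Fin 2)), K (x 1) := integral_congr_ae (ae_of_all _ hpt)
      _ = ∫ b, K b := integral_comp_eval_one hmeas
      _ = ∫ y in (-(1 / 2 : ℝ))..(1 / 2), K (y : UnitAddCircle) :=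
          integral_unitAddCircle_eq_intervalIntegral_half K
      _ = ∫ y in (-(1 / 2 : ℝ))..(1 / 2), (fanFun t y * Gt t y + γfun t y * Gy t y) := by
          refine intervalIntegral.integral_congr_uIoo fun y hy => ?_
          rw [uIoo_of_le hhalf] at hy
          simp only [hK_def]
          rw [α_coe_of_mem_Ioo hy, γ_coe_of_mem_Ioo hy]
  rw [setIntegral_congr_fun measurableSet_Ioo fun t _ => hL t, hB]
  -- the datum term
  congr 1
  have hpt0 : ∀ x : (UnitAddTorus (Fin 2)), ⟪vortexSheetData x, ψ 0 x⟫_ℝ =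
      (fun b : UnitAddCircle => vortexSheetProfile b * ψ 0 (Pi.single 1 b) 0) (x 1) := by
    intro x
    rw [inner_vortexSheetData, apply_eq_apply_single_of_forall_add_single (hinv 0) x]
  have hmeas0 : AEStronglyMeasurable
      (fun b : UnitAddCircle => vortexSheetProfile b * ψ 0 (Pi.single 1 b) 0) volume := by
    have hc : Continuous fun b : UnitAddCircle => ψ 0 (Pi.single 1 b) 0 :=
      (EuclideanSpace.proj (0 : Fin 2) : EuclideanSpace ℝ (Fin 2) →L[ℝ] ℝ).continuous.comp
        ((hψ.continuous_uncurry.comp (Continuous.prodMk_right 0)).comp hcs)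
    exact (measurable_vortexSheetProfile.mul hc.measurable).aestronglyMeasurable
  symm
  calc ∫ x, ⟪vortexSheetData x, ψ 0 x⟫_ℝ
      = ∫ x : (UnitAddTorus (Fin 2)), (fun b : UnitAddCircle => vortexSheetProfile b * ψ 0 (Pi.single 1 b) 0) (x 1) :=
        integral_congr_ae (ae_of_all _ hpt0)
    _ = ∫ b, vortexSheetProfile b * ψ 0 (Pi.single 1 b) 0 := integral_comp_eval_one hmeas0
    _ = ∫ y in (-(1 / 2 : ℝ))..(1 / 2), vortexSheetProfile (y : UnitAddCircle) *
          ψ 0 (Pi.single 1 (y : UnitAddCircle)) 0 :=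
        integral_unitAddCircle_eq_intervalIntegral_half _
    _ = ∫ y in (-(1 / 2 : ℝ))..(1 / 2), sgn y * G 0 y := by
        refine intervalIntegral.integral_congr_uIoo fun y hy => ?_
        rw [uIoo_of_le hhalf] at hy
        simp only [hG_def]
        rw [vortexSheetProfile_coe_of_mem_Ioo hy]

end InvariantTest


/-! ## The momentum identity for arbitrary test fields (reduction to the invariant case) -/

section GeneralTest

variable {ψ : ℝ → (UnitAddTorus (Fin 2)) → (EuclideanSpace ℝ (Fin 2))}

/-- Bounded measurable scalar functions on `T²` are integrable. [folklore] -/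
theorem integrable_of_abs_le {f : (UnitAddTorus (Fin 2)) → ℝ} (hf : Measurable f) {C : ℝ} (hC : ∀ x, |f x| ≤ C) :
    Integrable f volume :=
  memLp_one_iff_integrable.1 (MemLp.of_bound hf.aestronglyMeasurable C
    (ae_of_all _ fun x => by rw [Real.norm_eq_abs]; exact hC x))

/-- **Pairing an invariant scalar with a smooth scalar only sees the first-axis average of the
latter.** [folklore] -/
theorem integral_mul_eq_integral_mul_axisAvg {a b : (UnitAddTorus (Fin 2)) → ℝ}
    (hinv : ∀ (s : UnitAddCircle) (x : (UnitAddTorus (Fin 2))), a (x + Pi.single 0 s) = a x)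
    (ha : Integrable a volume) (hb : IsSmooth b) :
    ∫ x, a x * b x = ∫ x, a x * axisAvg 0 b x := by
  obtain ⟨C, hC⟩ := isCompact_univ.exists_bound_of_continuousOn hb.continuous.continuousOn
  have h := integral_inner_eq_integral_inner_axisAvg (G := ℝ) 0 hinv ha.aestronglyMeasurable
    hb.integrable (integrable_inner_shift_of_bound _ ha hb.continuous.aestronglyMeasurable
      fun x => hC x (mem_univ x))
  have hmul : ∀ a b : ℝ, a * b = ⟪a, b⟫_ℝ := fun a b => by simp [mul_comm]
  simp_rw [hmul]
  exact h

/-- The entries of `ū(t)` are integrable on `T²`. [folklore] -/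
theorem integrable_ubar (t : ℝ) (i j : Fin 2) : Integrable (fun x : (UnitAddTorus (Fin 2)) => ubar t x i j) volume := by
  have h1 : Measurable (uncurry fun t (x : (UnitAddTorus (Fin 2))) => ubar t x i j) := measurable_ubar i j
  have hm : Measurable (fun x : (UnitAddTorus (Fin 2)) => ubar t x i j) := h1.of_uncurry_left
  exact integrable_of_abs_le (f := fun x : (UnitAddTorus (Fin 2)) => ubar t x i j) hm (C := 1 / 2)
    (fun x => abs_ubar_le t x i j)

/-- `q̄(t)` is integrable on `T²`. [folklore] -/
theorem integrable_qbar (t : ℝ) : Integrable (qbar t) volume := by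
  have hm : Measurable (qbar t) := measurable_qbar.comp (measurable_const.prodMk measurable_id)
  exact integrable_of_abs_le (f := qbar t) hm (C := 1 / 2) (fun x => abs_qbar_le t x)

/-- The stress pairing `x ↦ ūᵢⱼ ∂ⱼψᵢ` is integrable on every slice. [folklore] -/
theorem integrable_ubar_mul_fderiv (hψ : IsSpaceTimeTest 1 ψ) (t : ℝ) (i j : Fin 2) :
    Integrable (fun x => ubar t x i j * Torus.fderiv (ψ t) x (EuclideanSpace.single j 1) i) volume := by
  have hs : IsSmooth fun x => Torus.lineDeriv (ψ t) x (EuclideanSpace.single j 1) :=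
    (hψ.isSmooth_slice t).lineDeriv _
  have hc : Continuous fun x => Torus.fderiv (ψ t) x (EuclideanSpace.single j 1) i := by
    have h : (fun x => Torus.fderiv (ψ t) x (EuclideanSpace.single j 1) i) =
        fun x => Torus.lineDeriv (ψ t) x (EuclideanSpace.single j 1) i := by
      funext x
      rw [Torus.lineDeriv_eq_fderiv_apply ((hψ.isSmooth_slice t).isContDiff (by simp))]
    rw [h]
    exact (hs.apply i).continuous
  obtain ⟨C, hC⟩ := isCompact_univ.exists_bound_of_continuousOn hc.continuousOn
  have h := (integrable_ubar t i j).bdd_mul hc.aestronglyMeasurable (ae_of_all _ fun x => hC x (mem_univ x))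
  simpa [mul_comm] using h

/-- The pressure pairing `x ↦ q̄ div ψ` is integrable on every slice. [folklore] -/
theorem integrable_qbar_mul_divergence (hψ : IsSpaceTimeTest 1 ψ) (t : ℝ) :
    Integrable (fun x => qbar t x * divergence (ψ t) x) volume := by
  have hc : Continuous (divergence (ψ t)) := (hψ.isSmooth_slice t).divergence.continuous
  obtain ⟨C, hC⟩ := isCompact_univ.exists_bound_of_continuousOn hc.continuousOn
  have h := (integrable_qbar t).bdd_mul hc.aestronglyMeasurable (ae_of_all _ fun x => hC x (mem_univ x))
  simpa [mul_comm] using h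

/-- **The momentum slice functional only sees the first-axis average of the test field**:
`∫ [⟪v̄, ∂ₜψ⟫ + ū : ∇ψ + q̄ div ψ](t) = ∫ [⟪v̄, ∂ₜψ̄⟫ + ū : ∇ψ̄ + q̄ div ψ̄](t)`. [folklore] -/
theorem integral_momentumIntegrand_eq_axisAvg (hψ : IsSpaceTimeTest 1 ψ) (t : ℝ) :
    ∫ x, (⟪vbar t x, timeDeriv ψ t x⟫_ℝ +
        ∑ i, ∑ j, ubar t x i j * Torus.fderiv (ψ t) x (EuclideanSpace.single j 1) i +
        qbar t x * divergence (ψ t) x) =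
      ∫ x, (⟪vbar t x, timeDeriv (fun t => axisAvg 0 (ψ t)) t x⟫_ℝ +
        ∑ i, ∑ j, ubar t x i j *
          Torus.fderiv (axisAvg 0 (ψ t)) x (EuclideanSpace.single j 1) i +
        qbar t x * divergence (axisAvg 0 (ψ t)) x) := by
  have hψb : IsSpaceTimeTest 1 (fun t => axisAvg 0 (ψ t)) := hψ.axisAvg 0
  have hsm : IsSmooth (ψ t) := hψ.isSmooth_slice t
  have hsmb : IsSmooth (axisAvg 0 (ψ t)) := hsm.axisAvg 0
  -- term 1
  have h1 : ∫ x, ⟪vbar t x, timeDeriv ψ t x⟫_ℝ =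
      ∫ x, ⟪vbar t x, timeDeriv (fun t => axisAvg 0 (ψ t)) t x⟫_ℝ := by
    have hA := memLp_vbar t
    have hB : IsSmooth (timeDeriv ψ t) := hψ.timeDeriv.isSmooth_slice t
    obtain ⟨C, hC⟩ := isCompact_univ.exists_bound_of_continuousOn hB.continuous.continuousOn
    rw [integral_inner_eq_integral_inner_axisAvg 0 (vbar_add_single t) hA.1 hB.integrable
        (integrable_inner_shift_of_bound _ (hA.integrable one_le_two) hB.continuous.aestronglyMeasurable
          fun x => hC x (mem_univ x))]
    refine integral_congr_ae (ae_of_all _ fun x => ?_)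
    show ⟪vbar t x, axisAvg 0 (timeDeriv ψ t) x⟫_ℝ = ⟪vbar t x, timeDeriv (fun t => axisAvg 0 (ψ t)) t x⟫_ℝ
    rw [Torus.timeDeriv_axisAvg hψ.1 0 t x]
  -- term 2, entrywise
  have h2 : ∀ i j : Fin 2, ∫ x, ubar t x i j * Torus.fderiv (ψ t) x (EuclideanSpace.single j 1) i =
      ∫ x, ubar t x i j * Torus.fderiv (axisAvg 0 (ψ t)) x (EuclideanSpace.single j 1) i := by
    intro i j
    have hs : IsSmooth fun x => Torus.lineDeriv (ψ t) x (EuclideanSpace.single j 1) := hsm.lineDeriv _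
    have hb : IsSmooth fun x => Torus.fderiv (ψ t) x (EuclideanSpace.single j 1) i := by
      have h : (fun x => Torus.fderiv (ψ t) x (EuclideanSpace.single j 1) i) =
          fun x => Torus.lineDeriv (ψ t) x (EuclideanSpace.single j 1) i := by
        funext x
        rw [Torus.lineDeriv_eq_fderiv_apply (hsm.isContDiff (by simp))]
      rw [h]
      exact hs.apply i
    rw [integral_mul_eq_integral_mul_axisAvg (fun s x => by rw [ubar_add_single]) (integrable_ubar t i j) hb]
    refine integral_congr_ae (ae_of_all _ fun x => ?_)
    show ubar t x i j * axisAvg 0 (fun x => Torus.fderiv (ψ t) x (EuclideanSpace.single j 1) i) x =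
      ubar t x i j * Torus.fderiv (axisAvg 0 (ψ t)) x (EuclideanSpace.single j 1) i
    congr 1
    have hc : Continuous fun y => Torus.fderiv (ψ t) y (EuclideanSpace.single j 1) := by
      have h : (fun y => Torus.fderiv (ψ t) y (EuclideanSpace.single j 1)) =
          fun y => Torus.lineDeriv (ψ t) y (EuclideanSpace.single j 1) := by
        funext y
        rw [Torus.lineDeriv_eq_fderiv_apply (hsm.isContDiff (by simp))]
      rw [h]
      exact hs.continuous
    rw [← Torus.axisAvg_apply_coord hc 0 i x, Torus.fderiv_axisAvg_apply hsm 0 x]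
  -- term 3
  have h3 : ∫ x, qbar t x * divergence (ψ t) x = ∫ x, qbar t x * divergence (axisAvg 0 (ψ t)) x := by
    rw [integral_mul_eq_integral_mul_axisAvg (qbar_add_single t) (integrable_qbar t) hsm.divergence,
      Torus.divergence_axisAvg hsm 0]
  -- assemble
  have hI1 := Torus.integrable_inner_timeDeriv_slice hψ (t := t) (memLp_vbar t)
  have hI1b := Torus.integrable_inner_timeDeriv_slice hψb (t := t) (memLp_vbar t)
  have hI2 : Integrable (fun x => ∑ i, ∑ j, ubar t x i j *
      Torus.fderiv (ψ t) x (EuclideanSpace.single j 1) i) volume :=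
    integrable_finsetSum _ fun i _ => integrable_finsetSum _ fun j _ => integrable_ubar_mul_fderiv hψ t i j
  have hI2b : Integrable (fun x => ∑ i, ∑ j, ubar t x i j *
      Torus.fderiv (axisAvg 0 (ψ t)) x (EuclideanSpace.single j 1) i) volume :=
    integrable_finsetSum _ fun i _ => integrable_finsetSum _ fun j _ =>
      integrable_ubar_mul_fderiv hψb t i j
  have hI3 := integrable_qbar_mul_divergence hψ t
  have hI3b := integrable_qbar_mul_divergence hψb t
  have hI12 : Integrable (fun x => ⟪vbar t x, timeDeriv ψ t x⟫_ℝ +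
      ∑ i, ∑ j, ubar t x i j * Torus.fderiv (ψ t) x (EuclideanSpace.single j 1) i) volume := hI1.add hI2
  have hI12b : Integrable (fun x => ⟪vbar t x, timeDeriv (fun t => axisAvg 0 (ψ t)) t x⟫_ℝ +
      ∑ i, ∑ j, ubar t x i j *
        Torus.fderiv (axisAvg 0 (ψ t)) x (EuclideanSpace.single j 1) i) volume := hI1b.add hI2b
  rw [integral_add hI12 hI3, integral_add hI1 hI2, integral_add hI12b hI3b,
    integral_add hI1b hI2b, h1, h3]
  congr 2
  rw [integral_finsetSum _ fun i _ => integrable_finsetSum _ fun j _ => integrable_ubar_mul_fderiv hψ t i j,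
    integral_finsetSum _ fun i _ => integrable_finsetSum _ fun j _ => integrable_ubar_mul_fderiv hψb t i j]
  refine Finset.sum_congr rfl fun i _ => ?_
  rw [integral_finsetSum _ fun j _ => integrable_ubar_mul_fderiv hψ t i j,
    integral_finsetSum _ fun j _ => integrable_ubar_mul_fderiv hψb t i j]
  exact Finset.sum_congr rfl fun j _ => h2 i j

/-- **The momentum identity of the explicit subsolution with initial datum** (Székelyhidi 2011,
§2: the triple `(v̄, ū, q̄)` solves (3) on `T² × (0,1)`, with `v̄(0) = v₀` the vortex sheet): for
every `E²`-valued space–time test field `ψ` on `[0,1)`,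
`∫₀¹∫ [⟪v̄, ∂ₜψ⟫ + ∑ᵢⱼ ūᵢⱼ ∂ⱼψᵢ + q̄ div ψ] = -∫ ⟪v₀, ψ(0)⟫`. Reduction to the invariant case
(`integral_momentumIntegrand_eq_axisAvg`) and `momentum_identity_of_invariant`.
[cite: Szekelyhidi2011, §2 (3), (9)–(10)] -/
theorem momentum_identity (hψ : IsSpaceTimeTest 1 ψ) :
    ∫ t in Ioo (0 : ℝ) 1, ∫ x, (⟪vbar t x, timeDeriv ψ t x⟫_ℝ +
        ∑ i, ∑ j, ubar t x i j * Torus.fderiv (ψ t) x (EuclideanSpace.single j 1) i +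
        qbar t x * divergence (ψ t) x) =
      -∫ x, ⟪vortexSheetData x, ψ 0 x⟫_ℝ := by
  have hψb : IsSpaceTimeTest 1 (fun t => axisAvg 0 (ψ t)) := hψ.axisAvg 0
  have hinvb : ∀ (t : ℝ) (s : UnitAddCircle) (x : (UnitAddTorus (Fin 2))),
      (fun t => axisAvg 0 (ψ t)) t (x + Pi.single 0 s) = (fun t => axisAvg 0 (ψ t)) t x :=
    fun t s x => axisAvg_add_single 0 (ψ t) s x
  have hM := momentum_identity_of_invariant hψb hinvb
  rw [setIntegral_congr_fun measurableSet_Ioo fun t _ => integral_momentumIntegrand_eq_axisAvg hψ t]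
  rw [hM]
  congr 1
  have hA := memLp_vortexSheetData
  have hB : IsSmooth (ψ 0) := hψ.isSmooth_slice 0
  obtain ⟨C, hC⟩ := isCompact_univ.exists_bound_of_continuousOn hB.continuous.continuousOn
  exact (integral_inner_eq_integral_inner_axisAvg 0 vortexSheetData_add_single hA.1 hB.integrable
    (integrable_inner_shift_of_bound _ (hA.integrable one_le_two) hB.continuous.aestronglyMeasurable
      fun x => hC x (mem_univ x))).symm

end GeneralTest


/-! ## Test fields past their time support -/

section PastSupport

variable {d : Type*} [Fintype d] [DecidableEq d]
variable {F : Type*} [NormedAddCommGroup F] [NormedSpace ℝ F]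

omit [Fintype d] [DecidableEq d] in
/-- The torus derivative of the zero field vanishes. [folklore] -/
theorem fderiv_zero_field (x : UnitAddTorus d) : Torus.fderiv (0 : UnitAddTorus d → F) x = 0 := by
  unfold Torus.fderiv
  exact fderiv_const_apply _

/-- The divergence of the zero field vanishes. [folklore] -/
theorem divergence_zero_field (x : UnitAddTorus d) :
    divergence (0 : UnitAddTorus d → EuclideanSpace ℝ d) x = 0 := by
  simp [Torus.divergence, Torus.partialDeriv, Torus.lineDeriv]

omit [Fintype d] [DecidableEq d] in
/-- **Past the time support of a space–time test field the time derivative vanishes**: if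
`ψ t' = 0` for all `t' ≥ T'` and `T' < t`, then `∂ₜψ(t) = 0`. [folklore] -/
theorem timeDeriv_eq_zero_of_lt {ψ : ℝ → UnitAddTorus d → F} {T' t : ℝ}
    (h0 : ∀ t', T' ≤ t' → ψ t' = 0) (ht : T' < t) (x : UnitAddTorus d) : timeDeriv ψ t x = 0 := by
  unfold Torus.timeDeriv
  have hev : (fun τ => ψ τ x) =ᶠ[nhds t] fun _ => (0 : F) := by
    filter_upwards [Ioi_mem_nhds ht] with τ hτ
    rw [h0 τ (le_of_lt hτ)]
    rfl
  rw [hev.deriv_eq, deriv_const]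

end PastSupport

/-! ## The momentum identity on `(0, T)`, `T ≤ 1` -/

section MomentumT

variable {T : ℝ} {ψ : ℝ → (UnitAddTorus (Fin 2)) → (EuclideanSpace ℝ (Fin 2))}

/-- **The momentum identity with initial datum on `[0, T)`, `T ≤ 1`**: for every `E²`-valued
space–time test field `ψ` on `[0,T)`,
`∫₀ᵀ∫ [⟪v̄, ∂ₜψ⟫ + ∑ᵢⱼ ūᵢⱼ ∂ⱼψᵢ + q̄ div ψ] = -∫ ⟪v₀, ψ(0)⟫` (the integrand vanishes on `[T, 1)`).
[cite: Szekelyhidi2011, §2 (3), (9)–(10)] -/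
theorem momentum_identity_of_le_one (hT1 : T ≤ 1) (hψ : IsSpaceTimeTest T ψ) :
    ∫ t in Ioo (0 : ℝ) T, ∫ x, (⟪vbar t x, timeDeriv ψ t x⟫_ℝ +
        ∑ i, ∑ j, ubar t x i j * Torus.fderiv (ψ t) x (EuclideanSpace.single j 1) i +
        qbar t x * divergence (ψ t) x) =
      -∫ x, ⟪vortexSheetData x, ψ 0 x⟫_ℝ := by
  obtain ⟨hs, T', hT', h0⟩ := hψ
  have hψ1 : IsSpaceTimeTest 1 ψ := ⟨hs, T', hT'.trans_le hT1, h0⟩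
  rw [← momentum_identity hψ1]
  symm
  refine setIntegral_eq_of_subset_of_forall_sdiff_eq_zero measurableSet_Ioo
    (Ioo_subset_Ioo_right hT1) fun t ht => ?_
  have hTt : T' < t := by
    rcases ht with ⟨ht1, ht2⟩
    by_contra h
    exact ht2 ⟨ht1.1, lt_of_le_of_lt (not_lt.1 h) hT'⟩
  have hzero : ∀ x : (UnitAddTorus (Fin 2)), ⟪vbar t x, timeDeriv ψ t x⟫_ℝ +
      ∑ i, ∑ j, ubar t x i j * Torus.fderiv (ψ t) x (EuclideanSpace.single j 1) i +
      qbar t x * divergence (ψ t) x = 0 := by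
    intro x
    rw [timeDeriv_eq_zero_of_lt h0 hTt, h0 t hTt.le, fderiv_zero_field, divergence_zero_field]
    simp
  simp_rw [hzero]
  exact integral_zero _ _

end MomentumT

/-! ## The explicit triple is a subsolution (Székelyhidi 2011, §2, verification of Def. 1.2) -/

section Subsolution

variable {ε c : ℝ}

/-- The slabs `[a, b] × T²` have finite space–time volume. [folklore] -/
theorem volume_slab_lt_top (a b : ℝ) : volume (Icc a b ×ˢ (univ : Set (UnitAddTorus (Fin 2)))) < ⊤ := by
  rw [Measure.volume_eq_prod, Measure.prod_prod]
  exact ENNReal.mul_lt_top measure_Icc_lt_top (measure_lt_top _ _)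

/-- Bounded measurable functions on `ℝ × T²` are integrable on the slabs `[a, b] × T²`. [folklore] -/
theorem integrableOn_slab_of_abs_le {f : ℝ × (UnitAddTorus (Fin 2)) → ℝ} (hf : Measurable f) {C : ℝ}
    (hC : ∀ p, |f p| ≤ C) (a b : ℝ) : IntegrableOn f (Icc a b ×ˢ (univ : Set (UnitAddTorus (Fin 2)))) volume :=
  IntegrableOn.of_bound (volume_slab_lt_top a b) hf.aestronglyMeasurable C
    (ae_of_all _ fun p => by rw [Real.norm_eq_abs]; exact hC p)

/-- **Székelyhidi's explicit triple `(v̄, ū, q̄)` is a subsolution of the incompressible Euler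
equations with respect to the energy density `ē = ½ - κ(1 - α²)`, `κ = (ε + cα)/4`,
`|ε| + |c| ≤ 1`, on `T² × (0, 1)`** (Székelyhidi 2011, Def. 1.2, verified in §2 for the choice
(9)–(11), `λ = ½`, `n = 2`; the odd modulation `c α` is an inessential generalization with the
same verification): the linear system (3) is `momentum_identity` (weak Burgers equation of the
rarefaction fan) and `isWeaklyDivFree_vbar`, the relaxed constitutive inequality (4) is
`defect_posSemidef`. [cite: Szekelyhidi2011, Def. 1.2, §2] -/
theorem isEulerSubsolutionOn (hεc : |ε| + |c| ≤ 1) :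
    IsEulerSubsolutionOn 1 (ebar ε c) vbar ubar qbar where
  aestronglyMeasurable_energy := (measurable_ebar ε c).aestronglyMeasurable
  aestronglyMeasurable_velocity := measurable_vbar.aestronglyMeasurable
  aestronglyMeasurable_stress i j := (measurable_ubar i j).aestronglyMeasurable
  aestronglyMeasurable_pressure := measurable_qbar.aestronglyMeasurable
  energy_nonneg := ae_of_all _ fun p => (by norm_num : (0 : ℝ) ≤ 1 / 4).trans (quarter_le_ebar hεc p.1 p.2)
  locallyIntegrable_energy a b _ _ := by
    refine integrableOn_slab_of_abs_le (measurable_ebar ε c) (C := 3 / 4) (fun p => ?_) a b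
    rw [uncurry, abs_of_nonneg ((by norm_num : (0 : ℝ) ≤ 1 / 4).trans (quarter_le_ebar hεc p.1 p.2))]
    exact ebar_le hεc p.1 p.2
  locallyIntegrable_velocity_sq a b _ _ := by
    have hm : Measurable fun p : ℝ × (UnitAddTorus (Fin 2)) => ‖vbar p.1 p.2‖ ^ 2 := (measurable_vbar.norm).pow_const 2
    refine integrableOn_slab_of_abs_le hm (C := 1) (fun p => ?_) a b
    rw [abs_of_nonneg (sq_nonneg _), norm_vbar_sq]
    exact α_sq_le p.1 (p.2 1)
  locallyIntegrable_stress i j a b _ _ :=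
    integrableOn_slab_of_abs_le (measurable_ubar i j) (C := 1 / 2) (fun p => abs_ubar_le p.1 p.2 i j) a b
  locallyIntegrable_pressure a b _ _ :=
    integrableOn_slab_of_abs_le measurable_qbar (C := 1 / 2) (fun p => abs_qbar_le p.1 p.2) a b
  stress_symm := ubar_isSymm
  stress_trace := trace_ubar
  momentum φ hφ := by
    rw [momentum_identity hφ.isSpaceTimeTest, hφ.apply_zero]
    simp
  divFree ψ hψ := by
    have h : ∀ t, ∫ x, ⟪vbar t x, Torus.gradient (ψ t) x⟫_ℝ = 0 := fun t =>
      isWeaklyDivFree_vbar t (ψ t) (hψ.isSpaceTimeTest.isSmooth_slice t)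
    simp_rw [h]
    exact integral_zero _ _
  relaxed := by
    refine ae_of_all _ fun p => ?_
    have h : 2 / (Fintype.card (Fin 2) : ℝ) * ebar ε c p.1 p.2 = ebar ε c p.1 p.2 := by
      rw [Fintype.card_fin]; norm_num
    rw [h]
    exact defect_posSemidef hεc p.1 p.2

end Subsolution


/-! ## The energy of the prescribed density: `∫ 2ē(·,t) = 1 - εt/3` (Székelyhidi 2011, (12)) -/

section Energy

variable {ε c : ℝ}

/-- `2ē = 1 - (ε + cα)(1 - α²)/2`. [cite: Szekelyhidi2011, (11)] -/
theorem two_mul_ebar_eq (ε c t : ℝ) (x : (UnitAddTorus (Fin 2))) :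
    2 * ebar ε c t x = 1 - (ε + c * α t (x 1)) * (1 - α t (x 1) ^ 2) / 2 := by
  simp only [ebar, κ]
  ring

/-- **The fan integral**: `∫_{-t/2}^{t/2} (ε + c·2y/t)(1 - (2y/t)²)/2 dy = εt/3` (the odd part
integrates to zero). [cite: Szekelyhidi2011, (12)] -/
theorem intervalIntegral_fan_poly {t : ℝ} (ht : 0 < t) (ε c : ℝ) :
    ∫ y in (-(t / 2))..(t / 2), (ε + c * (2 * y / t)) * (1 - (2 * y / t) ^ 2) / 2 = ε * t / 3 := by
  have ht0 : t ≠ 0 := ht.ne'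
  have hF : ∀ y, HasDerivAt (fun y : ℝ => ε / 2 * y - 2 * ε / (3 * t ^ 2) * y ^ 3 +
      c / (2 * t) * y ^ 2 - c / t ^ 3 * y ^ 4)
      ((ε + c * (2 * y / t)) * (1 - (2 * y / t) ^ 2) / 2) y := by
    intro y
    have h1 : HasDerivAt (fun y : ℝ => y) 1 y := hasDerivAt_id y
    have h2 : HasDerivAt (fun y : ℝ => y ^ 2) (2 * y) y := by simpa using hasDerivAt_pow 2 y
    have h3 : HasDerivAt (fun y : ℝ => y ^ 3) (3 * y ^ 2) y := by simpa using hasDerivAt_pow 3 y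
    have h4 : HasDerivAt (fun y : ℝ => y ^ 4) (4 * y ^ 3) y := by simpa using hasDerivAt_pow 4 y
    have h := (((h1.const_mul (ε / 2)).sub (h3.const_mul (2 * ε / (3 * t ^ 2)))).add
      (h2.const_mul (c / (2 * t)))).sub (h4.const_mul (c / t ^ 3))
    refine h.congr_deriv ?_
    field_simp
    ring
  rw [intervalIntegral.integral_eq_sub_of_hasDerivAt (fun y _ => hF y)
    ((by fun_prop : Continuous fun y : ℝ => (ε + c * (2 * y / t)) * (1 - (2 * y / t) ^ 2) / 2).intervalIntegrable _ _)]
  field_simp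
  ring

/-- **The energy identity of the prescribed density** (Székelyhidi 2011, Remarks, (12) with
`λ = ½`, integrated: `E(t) = ∫ ē dx`, `dE/dt = -ε/6`): for `0 < t ≤ 1`,
`∫_{T²} 2ē(x,t) dx = 1 - εt/3` (the modulation `cα(1-α²)` is odd across the fan and does not
contribute). [cite: Szekelyhidi2011, (12)] -/
theorem integral_two_mul_ebar {t : ℝ} (ht : 0 < t) (ht1 : t ≤ 1) (ε c : ℝ) :
    ∫ x, 2 * ebar ε c t x = 1 - ε * t / 3 := by
  have hhalf : (-(1 / 2 : ℝ)) ≤ 1 / 2 := by norm_num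
  set Q : UnitAddCircle → ℝ := fun b => (ε + c * α t b) * (1 - α t b ^ 2) / 2 with hQ_def
  have hQm : Measurable Q := by
    have hα := measurable_α t
    simp only [hQ_def]
    fun_prop
  have hQb : ∀ b, |Q b| ≤ (|ε| + |c|) / 2 := by
    intro b
    simp only [hQ_def]
    rw [abs_div, abs_mul, abs_two]
    have h1 : |ε + c * α t b| ≤ |ε| + |c| := by
      calc |ε + c * α t b| ≤ |ε| + |c * α t b| := abs_add_le _ _
        _ ≤ |ε| + |c| := by rw [abs_mul]; nlinarith [abs_α_le t b, abs_nonneg c]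
    have h2 : |1 - α t b ^ 2| ≤ 1 := by
      rw [abs_of_nonneg (one_sub_α_sq_nonneg t b)]
      nlinarith [sq_nonneg (α t b)]
    calc |ε + c * α t b| * |1 - α t b ^ 2| / 2 ≤ (|ε| + |c|) * 1 / 2 :=
          div_le_div_of_nonneg_right (mul_le_mul h1 h2 (abs_nonneg _) (by positivity)) (by norm_num)
      _ = (|ε| + |c|) / 2 := by ring
  have hQint : Integrable (fun x : (UnitAddTorus (Fin 2)) => Q (x 1)) volume :=
    integrable_of_abs_le (f := fun x : (UnitAddTorus (Fin 2)) => Q (x 1)) (hQm.comp (measurable_pi_apply 1))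
      (fun x => hQb (x 1))
  have hpt : ∀ x : (UnitAddTorus (Fin 2)), 2 * ebar ε c t x = 1 - Q (x 1) := fun x => two_mul_ebar_eq ε c t x
  simp_rw [hpt]
  rw [integral_sub (integrable_const 1) hQint]
  have h1 : ∫ _ : (UnitAddTorus (Fin 2)), (1 : ℝ) = 1 := by simp
  rw [h1, integral_comp_eval_one hQm.aestronglyMeasurable, integral_unitAddCircle_eq_intervalIntegral_half Q]
  -- the profile on the fundamental interval
  have hprof : ∫ y in (-(1 / 2 : ℝ))..(1 / 2), Q (y : UnitAddCircle) =
      ∫ y in (-(1 / 2 : ℝ))..(1 / 2), (ε + c * fanFun t y) * (1 - fanFun t y ^ 2) / 2 := by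
    refine intervalIntegral.integral_congr_uIoo fun y hy => ?_
    rw [uIoo_of_le hhalf] at hy
    simp only [hQ_def]
    rw [α_coe_of_mem_Ioo hy]
  rw [hprof]
  -- split at `±t/2`; the outer pieces vanish
  have hc : Continuous fun y => (ε + c * fanFun t y) * (1 - fanFun t y ^ 2) / 2 := by
    have := continuous_fanFun_right ht
    fun_prop
  have hI : ∀ a b : ℝ, IntervalIntegrable (fun y => (ε + c * fanFun t y) * (1 - fanFun t y ^ 2) / 2) volume a b :=
    fun a b => hc.intervalIntegrable a b
  rw [← intervalIntegral.integral_add_adjacent_intervals (hI (-(1 / 2)) (-(t / 2))) (hI (-(t / 2)) (1 / 2)),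
    ← intervalIntegral.integral_add_adjacent_intervals (hI (-(t / 2)) (t / 2)) (hI (t / 2) (1 / 2))]
  have hL : ∫ y in (-(1 / 2 : ℝ))..(-(t / 2)), (ε + c * fanFun t y) * (1 - fanFun t y ^ 2) / 2 = 0 := by
    rw [intervalIntegral.integral_congr (g := fun _ => (0 : ℝ)) fun y hy => ?_,
      intervalIntegral.integral_zero]
    rw [uIcc_of_le (by linarith)] at hy
    show (ε + c * fanFun t y) * (1 - fanFun t y ^ 2) / 2 = 0
    rw [fanFun_of_le ht hy.2]
    ring
  have hR : ∫ y in (t / 2)..(1 / 2 : ℝ), (ε + c * fanFun t y) * (1 - fanFun t y ^ 2) / 2 = 0 := by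
    rw [intervalIntegral.integral_congr (g := fun _ => (0 : ℝ)) fun y hy => ?_,
      intervalIntegral.integral_zero]
    rw [uIcc_of_le (by linarith)] at hy
    show (ε + c * fanFun t y) * (1 - fanFun t y ^ 2) / 2 = 0
    rw [fanFun_of_ge ht hy.1]
    ring
  have hM : ∫ y in (-(t / 2))..(t / 2), (ε + c * fanFun t y) * (1 - fanFun t y ^ 2) / 2 = ε * t / 3 := by
    rw [← intervalIntegral_fan_poly ht ε c]
    refine intervalIntegral.integral_congr fun y hy => ?_
    rw [uIcc_of_le (by linarith)] at hy
    show (ε + c * fanFun t y) * (1 - fanFun t y ^ 2) / 2 = (ε + c * (2 * y / t)) * (1 - (2 * y / t) ^ 2) / 2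
    rw [fanFun_of_abs_le ht (abs_le.2 ⟨hy.1, hy.2⟩)]
  rw [hL, hR, hM]
  ring

/-- `|v₁| = 1`: the vortex-sheet profile takes the values `±1`. [folklore] -/
theorem abs_vortexSheetProfile (s : UnitAddCircle) : |vortexSheetProfile s| = 1 := by
  unfold vortexSheetProfile AddCircle.liftIco
  simp only [Function.comp_apply, Set.restrict_apply]
  split_ifs <;> simp

/-- `‖v₀(x)‖ = 1`. [folklore] -/
theorem norm_vortexSheetData (x : (UnitAddTorus (Fin 2))) : ‖vortexSheetData x‖ = 1 := by
  rw [vortexSheetData, EuclideanSpace.norm_eq, Fin.sum_univ_two]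
  simp only [Matrix.cons_val_zero, Matrix.cons_val_one, Real.norm_eq_abs, abs_zero, sq_abs]
  have h : vortexSheetProfile (x 1) ^ 2 = 1 := by
    rw [← sq_abs, abs_vortexSheetProfile, one_pow]
  rw [h]
  simp

/-- **The energy of the vortex-sheet datum**: `∫⁻ ‖v₀‖ₑ² = 1`. [folklore] -/
theorem lintegral_enorm_sq_vortexSheetData : ∫⁻ x, ‖vortexSheetData x‖ₑ ^ 2 = 1 := by
  have h : ∀ x : (UnitAddTorus (Fin 2)), ‖vortexSheetData x‖ₑ ^ 2 = 1 := fun x => by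
    rw [← ofReal_norm, norm_vortexSheetData, ENNReal.ofReal_one, one_pow]
  simp_rw [h]
  simp

end Energy

/-! ## The modulation is visible: `ē(0,c,t) = ē(0,c',t)` a.e. forces `c = c'` -/

section Distinct

/-- On `T¹ = ℝ/ℤ`, points are null. [folklore] -/
theorem volume_singleton_unitAddCircle (b : UnitAddCircle) : volume ({b} : Set UnitAddCircle) = 0 := by
  rw [← Metric.closedBall_zero, AddCircle.volume_closedBall]
  simp

/-- On `T¹`, closed balls of radius `r ≤ ½` have volume `2r`. [folklore] -/
theorem volume_closedBall_unitAddCircle (b : UnitAddCircle) {r : ℝ} (hr : r ≤ 1 / 2) :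
    volume (Metric.closedBall b r) = ENNReal.ofReal (2 * r) := by
  rw [AddCircle.volume_closedBall, min_eq_right (by linarith)]

/-- In the closed inner half of the fan, `α = 2 rep / t` with `|rep s| = ‖s‖`, so
`|α(t,s)| = 2‖s‖/t`. [folklore] -/
theorem abs_α_eq_of_norm_le {t : ℝ} (ht : 0 < t) {s : UnitAddCircle} (hs : ‖s‖ ≤ t / 2) :
    |α t s| = 2 * ‖s‖ / t := by
  rw [α_eq_of_norm_le ht hs, abs_div, abs_mul, abs_two, abs_of_pos ht, abs_equivIco_eq_norm]

/-- **The modulation parameter is determined by the energy density**: for `0 < t ≤ 1`, if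
`ē(0,c,t,·) = ē(0,c',t,·)` a.e. on `T²` then `c = c'` (`ē(0,c) - ē(0,c') = (c' - c) α (1-α²)/4`,
and `α(1-α²) ≠ 0` on the punctured inner fan, a set of positive measure). [folklore] -/
theorem eq_of_ebar_zero_ae_eq {c c' t : ℝ} (ht : 0 < t) (ht1 : t ≤ 1)
    (h : ∀ᵐ x : (UnitAddTorus (Fin 2)), ebar 0 c t x = ebar 0 c' t x) : c = c' := by
  by_contra hne
  -- a.e. on `T²`, then a.e. on `T¹`, `α (1 - α²) = 0`
  have h2 : ∀ᵐ x : (UnitAddTorus (Fin 2)), α t (x 1) * (1 - α t (x 1) ^ 2) = 0 := by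
    filter_upwards [h] with x hx
    have hx' : (c' - c) * (α t (x 1) * (1 - α t (x 1) ^ 2)) = 0 := by
      simp only [ebar, κ, zero_add] at hx
      linarith
    rcases mul_eq_zero.1 hx' with h0 | h0
    · exact absurd (sub_eq_zero.1 h0).symm hne
    · exact h0
  have hmp : MeasurePreserving (fun x : (UnitAddTorus (Fin 2)) => x 1) volume volume :=
    measurePreserving_eval (fun _ : Fin 2 => (volume : Measure UnitAddCircle)) 1
  have hmeas : MeasurableSet {b : UnitAddCircle | α t b * (1 - α t b ^ 2) = 0} :=
    (measurable_α t).mul (measurable_const.sub ((measurable_α t).pow_const 2)) (measurableSet_singleton 0)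
  have h3 : ∀ᵐ b : UnitAddCircle, α t b * (1 - α t b ^ 2) = 0 := by
    have h' := (ae_map_iff hmp.measurable.aemeasurable hmeas).2 h2
    rwa [hmp.map_eq] at h'
  -- but the punctured ball `{0 < ‖s‖ ≤ t/4}` has positive measure and `α(1-α²) ≠ 0` there
  have hsub : Metric.closedBall (0 : UnitAddCircle) (t / 4) \ {0} ⊆
      {b : UnitAddCircle | α t b * (1 - α t b ^ 2) ≠ 0} := by
    rintro s ⟨hs, hs0⟩
    rw [Metric.mem_closedBall, dist_zero_right] at hs
    have hnorm : 0 < ‖s‖ := norm_pos_iff.2 hs0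
    have habs : |α t s| = 2 * ‖s‖ / t := abs_α_eq_of_norm_le ht (by linarith)
    have hα0 : α t s ≠ 0 := by
      intro h0
      rw [h0, abs_zero] at habs
      have : 0 < 2 * ‖s‖ / t := by positivity
      linarith
    have hα1 : 1 - α t s ^ 2 ≠ 0 := by
      have hle : |α t s| ≤ 1 / 2 := by
        rw [habs, div_le_iff₀ ht]
        linarith
      have : α t s ^ 2 ≤ 1 / 4 := by
        have h' := abs_le.1 hle
        nlinarith [h'.1, h'.2]
      linarith
    exact mul_ne_zero hα0 hα1
  have hpos : 0 < volume (Metric.closedBall (0 : UnitAddCircle) (t / 4) \ {0}) := by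
    rw [measure_sdiff_null (volume_singleton_unitAddCircle 0),
      volume_closedBall_unitAddCircle 0 (by linarith)]
    exact ENNReal.ofReal_pos.2 (by linarith)
  have hzero : volume {b : UnitAddCircle | α t b * (1 - α t b ^ 2) ≠ 0} = 0 := by
    rw [ae_iff] at h3
    simpa using h3
  exact absurd ((measure_mono hsub).trans_eq hzero) (not_le.2 hpos)

end Distinct

/-! ## Weak continuity of `v̄` into `L²` -/

section WeakContinuity

/-- **`t ↦ α(t, y)` is continuous for `y ≠ 0`** (constant `sgn y` until the fan arrives at
`t = 2|y|`, then `2y/t`, matching there). [folklore] -/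
theorem continuous_fanFun_left {y : ℝ} (hy : y ≠ 0) : Continuous fun t => fanFun t y := by
  refine continuous_iff_continuousAt.2 fun t₀ => ?_
  by_cases h : t₀ < 2 * |y|
  · have hev : (fun t => fanFun t y) =ᶠ[nhds t₀] fun _ => sgn y := by
      filter_upwards [Iio_mem_nhds h] with t ht
      exact fanFun_eq_sgn hy (le_of_lt ht)
    exact (continuousAt_const.congr hev.symm)
  · have hpos : 0 < t₀ := lt_of_lt_of_le (by positivity : 0 < 2 * |y|) (not_lt.1 h)
    have hev : (fun t => fanFun t y) =ᶠ[nhds t₀] fun t => clamp1 (2 * y / t) := by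
      filter_upwards [Ioi_mem_nhds hpos] with t ht
      exact fanFun_of_pos ht y
    have hc : ContinuousAt (fun t => clamp1 (2 * y / t)) t₀ :=
      (continuous_clamp1.continuousAt).comp
        ((continuousAt_const.div continuousAt_id hpos.ne'))
    exact hc.congr hev.symm

/-- `t ↦ α(t, s)` is continuous for `s ≠ 0`. [folklore] -/
theorem continuous_α_left {s : UnitAddCircle} (hs : s ≠ 0) : Continuous fun t => α t s := by
  have hy : (AddCircle.equivIco 1 (-(1 / 2 : ℝ)) s : ℝ) ≠ 0 := by
    intro h0
    apply hs
    have h1 : ((AddCircle.equivIco 1 (-(1 / 2 : ℝ)) s : ℝ) : UnitAddCircle) = s := AddCircle.coe_equivIco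
    rw [← h1, h0]
    rfl
  simp_rw [α_eq_fanFun_equivIco]
  exact continuous_fanFun_left hy

/-- Almost every point of `T²` has non-zero second coordinate. [folklore] -/
theorem ae_eval_one_ne_zero : ∀ᵐ x : (UnitAddTorus (Fin 2)), x 1 ≠ 0 := by
  have hmp : MeasurePreserving (fun x : (UnitAddTorus (Fin 2)) => x 1) volume volume :=
    measurePreserving_eval (fun _ : Fin 2 => (volume : Measure UnitAddCircle)) 1
  have h : volume {x : (UnitAddTorus (Fin 2)) | x 1 = 0} = 0 := by
    have h' := hmp.measure_preimage (measurableSet_singleton (0 : UnitAddCircle)).nullMeasurableSet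
    rw [volume_singleton_unitAddCircle] at h'
    exact h'
  rw [ae_iff]
  simpa using h

/-- **`v̄ ∈ C(ℝ; L²_w(T²))`**: `t ↦ ∫ ⟪v̄(t), g⟫` is continuous for every `g ∈ L²(T²)` (dominated
convergence: `|⟪v̄, g⟫| ≤ ‖g‖`, and `t ↦ α(t, x₂)` is continuous for `x₂ ≠ 0`).
[cite: Szekelyhidi2011, Thm. 1.4 hypotheses ("v̄ ∈ C([0,T]; L²_w)"), verified in §2] -/
theorem continuous_integral_inner_vbar {g : (UnitAddTorus (Fin 2)) → (EuclideanSpace ℝ (Fin 2))} (hg : MemLp g 2 volume) :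
    Continuous fun t => ∫ x, ⟪vbar t x, g x⟫_ℝ := by
  refine continuous_of_dominated (bound := fun x => ‖g x‖) (fun t => ?_) (fun t => ?_) ?_ ?_
  · exact (measurable_vbar_slice t).aestronglyMeasurable.inner hg.1
  · refine ae_of_all _ fun x => ?_
    calc ‖⟪vbar t x, g x⟫_ℝ‖ ≤ ‖vbar t x‖ * ‖g x‖ := norm_inner_le_norm _ _
      _ ≤ 1 * ‖g x‖ := mul_le_mul_of_nonneg_right (norm_vbar_le t x) (norm_nonneg _)
      _ = ‖g x‖ := one_mul _
  · exact (hg.integrable one_le_two).norm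
  · filter_upwards [ae_eval_one_ne_zero] with x hx
    simp_rw [inner_vbar]
    exact (continuous_α_left hx).mul continuous_const

end WeakContinuity


/-! ## Small facts for the assembly of Theorem 1.1 -/

section Assembly

/-- `v̄(0) = v₀`: at `t = 0` the explicit velocity is the vortex-sheet datum.
[cite: Szekelyhidi2011, Thm. 1.4 hypotheses ("v̄(0) = v₀"), §2] -/
theorem vbar_zero : vbar 0 = vortexSheetData := by
  funext x
  simp only [vbar, vortexSheetData, α_zero]

/-- **The prescribed kinetic energy density**: if `v ⊗ v - M = e Id` with `M` trace-free
(`2 × 2`), then `|v|² = 2e` (take traces; Székelyhidi 2011, (7): "`½|v|² = ē`").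
[cite: Szekelyhidi2011, (6)–(7)] -/
theorem norm_sq_eq_two_mul_of_vecMulVec_sub_eq {v : (EuclideanSpace ℝ (Fin 2))} {M : Matrix (Fin 2) (Fin 2) ℝ} {e : ℝ}
    (hM : M.trace = 0) (h : Matrix.vecMulVec v v - M = e • (1 : Matrix (Fin 2) (Fin 2) ℝ)) :
    ‖v‖ ^ 2 = 2 * e := by
  have ht := congrArg Matrix.trace h
  rw [Matrix.trace_sub, hM, sub_zero, Matrix.trace_vecMulVec, Matrix.trace_smul, Matrix.trace_one,
    Fintype.card_fin, smul_eq_mul] at ht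
  have hvv : (v : Fin 2 → ℝ) ⬝ᵥ (v : Fin 2 → ℝ) = ‖v‖ ^ 2 := by
    rw [EuclideanSpace.norm_sq_eq, dotProduct]
    refine Finset.sum_congr rfl fun i _ => ?_
    rw [Real.norm_eq_abs, sq_abs, sq]
  rw [← hvv, ht]
  push_cast
  ring

/-- Off the turbulent zone the explicit velocity already has the prescribed energy:
`|v̄(t,x)|² = 2ē(t,x)` if `(t,x) ∉ U`, `0 < t < 1`. [cite: Szekelyhidi2011, §2 (8)] -/
theorem norm_vbar_sq_eq_two_mul_ebar_of_not_mem_U {ε c t : ℝ} (ht : 0 < t) (ht1 : t < 1) {x : (UnitAddTorus (Fin 2))}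
    (hx : (t, x) ∉ U) : ‖vbar t x‖ ^ 2 = 2 * ebar ε c t x := by
  have hα := α_sq_eq_one_of_not_mem_U ht ht1 hx
  rw [norm_vbar_sq, hα, ebar_eq_half_of_α_sq hα]
  norm_num

/-- A space–time test field on `[0, T)` is one on `[0, T'')` for every `T'' ≥ T`. [folklore] -/
theorem IsSpaceTimeTest.of_le {F : Type*} [NormedAddCommGroup F] [NormedSpace ℝ F] {T T'' : ℝ}
    {ψ : ℝ → (UnitAddTorus (Fin 2)) → F} (hψ : IsSpaceTimeTest T ψ) (h : T ≤ T'') : IsSpaceTimeTest T'' ψ := by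
  obtain ⟨hs, T', hT', h0⟩ := hψ
  exact ⟨hs, T', hT'.trans_le h, h0⟩

end Assembly

end VortexSheet

end Literature.Barriers.AnomalousDissipation

end
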